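import Mathlib.Analysis.InnerProductSpace.PiL2
import Mathlib.Analysis.SpecialFunctions.Complex.Arg
import Mathlib.Analysis.SpecialFunctions.Trigonometric.Inverse
import Mathlib.Data.Set.Card
import Mathlib.Data.Sym.Sym2
import Mathlib.Data.Finset.Sort
import Literature.Geometry.DiscreteGeometry.KissingNodeDegree
import Literature.Geometry.DiscreteGeometry.KissingRigidity
import HarnessLib

/-!
# Node types in the contact graph of a kissing configuration
# (Hales 2012, Lemma 7, second assertion; Lemma 9, the linear constraints at a node) — proved

Topic `Literature/Geometry/DiscreteGeometry`; provefact item for `Hales2012_kissingTwelve` (sibling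
of `FejesTothKissingTwelve.lean`, `KissingNodeDegree.lean`, `KissingRigidity.lean`).  Hales's proof
of Fejes Tóth's kissing-twelve conjecture is vendored down to two computer-assisted named facts
(`flyspeck_L12`, `Hales2012_contactGraphFccOrHcp`); its pen-and-paper steps are being PROVED
bottom-up: Lemma 2 and the assembly of Theorem 1 (`FejesTothKissingTwelve.lean`), Lemma 10
(`KissingRigidity.lean`), the first assertion of Lemma 7 (`KissingNodeDegree.lean`: node degrees
`≤ 4`), and here the **second assertion of Lemma 7** — the possible *types* of a node all of whose
faces are triangles or quadrilaterals — which supplies the table `b(p, q)` of Definition 9 and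
property 10 (weights) of *tame contact* (Definition 12, Theorem 3).

## Source

Hales, arXiv:1209.6043, p. 11: "We say that a node of a fan `(V, E)` has type `(p, q, r) ∈ ℕ³` if
at the node there are `p + q + r` faces, of which `p` are triangles and `q` are quadrilaterals."
P. 12: "**Lemma 7.** Let `V ∈ 𝒱`. Every node of `(V, E₂(V))` has degree at most four.
Furthermore, suppose the type of a node is `(p, q, 0)`. Then `(p, q)` must be `(0, 3)`, `(1, 3)`,
or `(2, 2)`.  *Proof.* The interior angles of a spherical polygon in the contact graph have the
following lower `αₖ` and upper bounds `βₖ`, as a function of the number of sides `k`: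
`α₃ = β₃ = dih(2,2,2,2,2,2)`; `α₄ = dih(2,2,2,2h₀,2,2)`, `β₄ = 2 dih(2,2,2,2,2h₀,2)`;
`α₅ = dih(2,2,2,2h₀,2,2)`, `β₅ = 2π` (`k ≥ 5`).  Thus `p α₃ + q α₄ + r α₅ ≤ 2π ≤ p β₃ + q β₄ + r β₅`.
There are no solutions for `(p, q, r)` in natural numbers when `p + q + r ≥ 5` and only the three
given solutions in `(p, q, r)` with `r = 0`."

## The formalisation (hypermap-free, local at the node)

The contact hypermap `hyp(V, E₂(V))` and its faces are not vendored; the statement is rendered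
through the geometry at the node, exactly as Hales's proof uses it.  Fix a kissing configuration
`S` (`IsKissingConfig`, Definition 1) and a node `v` with its `d = deg v ≤ 4` contacts, seen in the
tangent plane at `v` through their tangent angles (`tangentArg`; Part D): the `d` corners at `v`
are the gaps between azimuthally consecutive contacts and sum to `2π`.

* A **triangle pair** at `v` (`trianglePairs S v`) is a contact pair `{u, w}` of contacts of `v`
  (a triangle `{v, u, w}` of the contact graph); its corner is `α₃ = arccos (1/3)`
  (`cos_tangentArg_sub_eq_third`), the least possible gap, so `u, w` are consecutive: these are the
  triangular faces at `v`, `p = |trianglePairs S v|`.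
* A **rhombus pair** at `v` (`rhombusPairs S v`) is a pair `{u, w}` of distinct non-contact
  contacts of `v` with a second common contact `x ≠ v`, `x` not a contact of `v`: then `x` is the
  mirror image of `v` in the plane of `0, u, w` (the rhombus lemma `rhombus_smul_add_eq` of
  `KissingRigidity.lean`), `v, u, x, w` is a spherical rhombus of side `2` — a quadrilateral face
  at `v` — and its corner at `v` satisfies `α₄ ≤ corner ≤ β₄` with `cos α₄ = 1 − (2h₀)²/6 < 0`
  (`cos_tangentArg_sub_le_of_separated`) and `cos β₄ = (5h₀² − 12)/(3(4 − h₀²)) ≈ −0.561 > −7/9 =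
  cos 2α₃` (`le_cos_tangentArg_sub_of_rhombus`, from `‖v − x‖ ≥ 2h₀`); as `β₄ < 2α₃`, rhombus
  pairs are consecutive too; `q = |rhombusPairs S v|`.  (Excluding `x ∈ E(v)` rules out the two
  outer contacts of a pair of adjacent triangles, which do not bound a common face.)
* "Type `(p, q, 0)`" (every face at `v` is a triangle or a quadrilateral) thus reads
  `p + q = deg v` with `deg v ≥ 1`; for `deg v ∈ {1, 2}` this already fails (there are fewer pairs
  than corners), and for `deg v ∈ {3, 4}` it says that every corner is a triangle or rhombus corner.

`IsKissingConfig.node_type` then proves `(p, q) ∈ {(0, 3), (1, 3), (2, 2)}` by Hales's angle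
count: with `d = 4`, the two diagonal pairs have gap `≥ 2α₃` (cosine `≤ −7/9`), so all four
consecutive gaps are `α₃` or obtuse rhombus gaps `≤ β₄`; four obtuse gaps exceed `2π`, three
triangle gaps leave `2π − 3α₃` of cosine `cos 3α₃ = −23/27 < cos β₄`, four give `4α₃ < 2π`: so
`(p, q) = (1, 3)` or `(2, 2)`.  With `d = 3`: two triangle gaps leave `2π − 2α₃ > π`, one leaves
two rhombus gaps summing to `2π − α₃`, the larger `≥ π − α₃/2` of cosine `≤ −√(2/3) < cos β₄`,
three give `3α₃ < 2π`: so `(p, q) = (0, 3)`.  Only the two numerical facts `cos α₄ < 0` and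
`cos β₄ > −7/9` about `h₀ = 1.26` enter (`node_type_thresholds`).

Finally (Part H) the four "linear programming constraints that are immediately available" in
the proof of Lemma 9 (p. 13: "1. The angles around each node sum to `2π`. 2. Each angle of a
triangle is `α₃`. 3. Each angle of each rhombus lies between `α₄` and `β₄`. 4. The opposite angles
of each rhombus are equal.") are proved at every node of type `(p, q, 0)`: with the corner of a
pair `{u, w}` of contacts of a node measured by `cornerAngle {u, w} = arccos ((⟪u, w⟫ − 1)/3)`
(the same number at the two opposite nodes `v`, `x` of a rhombus `v, u, x, w` — constraint 4),
`IsKissingConfig.corner_sum` gives `p · arccos (1/3) + Σ_{rhombus pairs} cornerAngle = 2π`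
(constraints 1–2), `cornerAngle_bounds_of_mem_rhombusPairs` gives constraint 3, and
`rhombus_corner_sum` lists the node equation for each of the three node types.  (These are the
rows of the linear programs that exclude five of the eight tame-contact hypermaps in Lemma 9; the
list of eight hypermaps itself, Lemma 8, is a computer classification [Hal12b] not vendored here.)

## Contents (namespace `Literature.DiscreteGeom`)

* Part A: constants (`pi_div_three_lt_arccos_third`, `cos_three_mul_arccos_third`,
  `seven_ninths_lt_cos_half_arccos_third`, `cos_le_neg_seven_ninths`, …).
* Part B: `card_filter_of_four_gaps`, `card_filter_of_three_gaps` (the integer solutions).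
* Part C: `ncard_eq_of_sorted_four`, `ncard_eq_of_sorted_three`, `false_of_sorted_two`,
  `false_of_sorted_one` (sorted tangent directions and sets of triangle/rhombus pairs).
* Part D: `tangentArg`, `tangent_coords`, `inner_eq_one_add_three_mul_cos`,
  `cos_tangentArg_sub_eq_third` (`α₃`), `cos_tangentArg_sub_le_of_separated` (`α₄`),
  `le_cos_tangentArg_sub_of_rhombus` (`β₄`), `node_type_thresholds`.
* Part E: `trianglePairs`, `rhombusPairs` and their membership lemmas.
* Part F: `exists_sorted_enum`, `ncard_eq_ncard_preimage_sym2Map`.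
* Part G: `IsKissingConfig.node_type` (Lemma 7, second assertion),
  `IsKissingConfig.ncard_neighborSet_of_node_type` (such nodes have degree `3` or `4`).
* Part H: `sum_of_sorted_four`, `sum_of_sorted_three`, `cornerAngle` (the corner of a face at a
  node as a function of the pair of neighbours along it: `tangentAngle ⟪u, w⟫` with the
  `tangentAngle s = arccos ((s − 1)/3)` of `KissingRigidity.lean`), `tangentAngle_inner_eq_arccos_cos`,
  `tangentAngle_inner_eq_arccos_third`, `le_inner_of_rhombus`,
  `IsKissingConfig.cornerAngle_of_mem_trianglePairs`,
  `IsKissingConfig.cornerAngle_bounds_of_mem_rhombusPairs`, `IsKissingConfig.corner_sum`,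
  `IsKissingConfig.rhombus_corner_sum` (Lemma 9, linear constraints 1–4 at a node).

## References

* T. C. Hales, *A proof of Fejes Tóth's conjecture on sphere packings with kissing number twelve*,
  arXiv:1209.6043 (2012): Lemma 7 and its proof (table (7)), p. 12; the type `(p, q, r)` of a
  node, p. 11; Definitions 9–12 and Theorem 3, pp. 10–12; Lemma 9 and its proof (the four linear
  programming constraints), p. 13 (`Hales2012`).
-/

noncomputable section

namespace Literature.Geometry.DiscreteGeometry

open Real

/-! ### Part A. More constants around `α = arccos (1/3)` -/

/-- `π/3 < arccos (1/3)` (as `1/3 < 1/2 = cos (π/3)`). [folklore] -/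
theorem pi_div_three_lt_arccos_third : π / 3 < arccos (1 / 3) := by
  have h : arccos (1 / 2) = π / 3 := by
    rw [← cos_pi_div_three, arccos_cos (by positivity) (by linarith [pi_pos])]
  rw [← h]
  exact arccos_lt_arccos (by norm_num) (by norm_num) (by norm_num)

/-- `arccos (1/3) < π/2` (as `0 < 1/3`). [folklore] -/
theorem arccos_third_lt_pi_div_two : arccos (1 / 3) < π / 2 := by
  rw [← arccos_zero]
  exact arccos_lt_arccos (by norm_num) (by norm_num) (by norm_num)

/-- `cos (3 · arccos (1/3)) = −23/27`. [folklore] -/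
theorem cos_three_mul_arccos_third : cos (3 * arccos (1 / 3)) = -23 / 27 := by
  rw [cos_three_mul, cos_arccos (by norm_num) (by norm_num)]
  norm_num

/-- `7/9 < cos (arccos (1/3) / 2) (= √(2/3))`. [folklore] -/
theorem seven_ninths_lt_cos_half_arccos_third : 7 / 9 < cos (arccos (1 / 3) / 2) := by
  have hsq : cos (arccos (1 / 3) / 2) ^ 2 = 2 / 3 := by
    rw [cos_sq, show 2 * (arccos (1 / 3) / 2) = arccos (1 / 3) by ring,
      cos_arccos (by norm_num) (by norm_num)]
    norm_num
  have hpos : 0 < cos (arccos (1 / 3) / 2) := by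
    apply cos_pos_of_mem_Ioo
    constructor
    · linarith [arccos_nonneg (1 / 3 : ℝ), pi_pos]
    · linarith [arccos_third_lt_pi_div_two, pi_pos]
  nlinarith [hsq, hpos]

/-- On `[2α, 2π − 2α]` (`α = arccos (1/3)`) the cosine is at most `cos 2α = −7/9`. [folklore] -/
theorem cos_le_neg_seven_ninths {y : ℝ} (h₁ : 2 * arccos (1 / 3) ≤ y)
    (h₂ : y ≤ 2 * π - 2 * arccos (1 / 3)) : cos y ≤ -7 / 9 := by
  have h0 : 0 ≤ 2 * arccos (1 / 3) := by linarith [arccos_nonneg (1 / 3 : ℝ)]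
  rw [← cos_two_mul_arccos_third]
  by_cases hy : y ≤ π
  · exact cos_le_cos_of_nonneg_of_le_pi h0 hy h₁
  · rw [← cos_two_pi_sub y]
    exact cos_le_cos_of_nonneg_of_le_pi h0 (by linarith) (by linarith)

/-- A gap in `[0, π]` with cosine `1/3` is `arccos (1/3)`. [folklore] -/
theorem eq_arccos_third_of_cos_eq {g : ℝ} (h0 : 0 ≤ g) (hπ : g ≤ π) (hc : cos g = 1 / 3) :
    g = arccos (1 / 3) := by
  rw [← hc, arccos_cos h0 hπ]

/-- A gap in `[0, π]` with negative cosine exceeds `π/2`. [folklore] -/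
theorem pi_div_two_lt_of_cos_neg {g : ℝ} (h0 : 0 ≤ g) (hc : cos g < 0) : π / 2 < g := by
  by_contra h
  have : 0 ≤ cos g := cos_nonneg_of_neg_pi_div_two_le_of_le (by linarith [pi_pos]) (le_of_not_gt h)
  linarith

/-- The symmetric form `cos (a − b) = cos (b − a)`. [folklore] -/
theorem cos_sub_rev (a b : ℝ) : cos (a - b) = cos (b - a) := by
  rw [← cos_neg, neg_sub]

/-! ### Part B. Four sorted directions: the node types `(1, 3)` and `(2, 2)` -/

/-- **Arithmetic of four gaps.** Four gaps around a node summing to `2π`, each either a triangle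
gap (`= α = arccos (1/3)`, recorded by `p k`) or a rhombus gap (`> π/2`, cosine `≥ κ > −7/9`):
then the number of triangle gaps is `1` or `2` (not `0`: four obtuse gaps exceed `2π`; not `3`:
the fourth gap would be `2π − 3α`, of cosine `cos 3α = −23/27 < κ`; not `4`: `4α < 2π`).
[cite: Hales2012, Lemma 7 (proof)] -/
theorem card_filter_of_four_gaps {κ : ℝ} (hκ : -7 / 9 < κ) (g : Fin 4 → ℝ) (p : Fin 4 → Prop)
    [DecidablePred p] (hsum : g 0 + g 1 + g 2 + g 3 = 2 * π)
    (hP : ∀ k, p k → g k = arccos (1 / 3))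
    (hQ : ∀ k, ¬p k → π / 2 < g k ∧ κ ≤ cos (g k)) :
    (Finset.univ.filter p).card = 1 ∨ (Finset.univ.filter p).card = 2 := by
  have hα2 := arccos_third_lt_pi_div_two
  have hπ := pi_pos
  have hbad : ∀ x, κ ≤ cos x → x = 2 * π - 3 * arccos (1 / 3) → False := by
    intro x hx he
    rw [he, cos_two_pi_sub, cos_three_mul_arccos_third] at hx
    linarith
  rw [Finset.card_filter, Fin.sum_univ_four]
  by_cases h0 : p 0 <;> by_cases h1 : p 1 <;> by_cases h2 : p 2 <;> by_cases h3 : p 3 <;>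
    simp only [h0, h1, h2, h3, if_true, if_false] <;> norm_num
  · linarith [hP 0 h0, hP 1 h1, hP 2 h2, hP 3 h3]
  · exact hbad _ (hQ 3 h3).2 (by linarith [hP 0 h0, hP 1 h1, hP 2 h2])
  · exact hbad _ (hQ 2 h2).2 (by linarith [hP 0 h0, hP 1 h1, hP 3 h3])
  · exact hbad _ (hQ 1 h1).2 (by linarith [hP 0 h0, hP 2 h2, hP 3 h3])
  · exact hbad _ (hQ 0 h0).2 (by linarith [hP 1 h1, hP 2 h2, hP 3 h3])
  · linarith [(hQ 0 h0).1, (hQ 1 h1).1, (hQ 2 h2).1, (hQ 3 h3).1]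

/-- **Arithmetic of three gaps.** Three gaps summing to `2π`, each either a triangle gap (`= α`)
or a rhombus gap (in `(π/2, π]`, cosine `≥ κ > −7/9`): then all three are rhombus gaps (two
triangle gaps leave `2π − 2α > π`; one leaves two rhombus gaps summing to `2π − α`, the larger
being `≥ π − α/2`, of cosine `≤ −cos (α/2) = −√(2/3) < κ`; three give `3α < 2π`).
[cite: Hales2012, Lemma 7 (proof)] -/
theorem card_filter_of_three_gaps {κ : ℝ} (hκ : -7 / 9 < κ) (g : Fin 3 → ℝ) (p : Fin 3 → Prop)
    [DecidablePred p] (hsum : g 0 + g 1 + g 2 = 2 * π)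
    (hP : ∀ k, p k → g k = arccos (1 / 3))
    (hQ : ∀ k, ¬p k → g k ≤ π ∧ π / 2 < g k ∧ κ ≤ cos (g k)) :
    (Finset.univ.filter p).card = 0 := by
  have hα2 := arccos_third_lt_pi_div_two
  have hπ := pi_pos
  have hbad : ∀ x, κ ≤ cos x → π - arccos (1 / 3) / 2 ≤ x → x ≤ π → False := by
    intro x hx h1 h2
    have hc : cos x ≤ cos (π - arccos (1 / 3) / 2) :=
      cos_le_cos_of_nonneg_of_le_pi (by linarith [arccos_nonneg (1 / 3 : ℝ)]) h2 h1
    rw [cos_pi_sub] at hc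
    linarith [seven_ninths_lt_cos_half_arccos_third]
  rw [Finset.card_filter, Fin.sum_univ_three]
  by_cases h0 : p 0 <;> by_cases h1 : p 1 <;> by_cases h2 : p 2 <;>
    simp only [h0, h1, h2, if_true, if_false] <;> norm_num
  · linarith [hP 0 h0, hP 1 h1, hP 2 h2]
  · linarith [hP 0 h0, hP 1 h1, (hQ 2 h2).1]
  · linarith [hP 0 h0, hP 2 h2, (hQ 1 h1).1]
  · rcases le_total (g 1) (g 2) with h | h
    · exact hbad _ (hQ 2 h2).2.2 (by linarith [hP 0 h0]) (hQ 2 h2).1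
    · exact hbad _ (hQ 1 h1).2.2 (by linarith [hP 0 h0]) (hQ 1 h1).1
  · linarith [hP 1 h1, hP 2 h2, (hQ 0 h0).1]
  · rcases le_total (g 0) (g 2) with h | h
    · exact hbad _ (hQ 2 h2).2.2 (by linarith [hP 1 h1]) (hQ 2 h2).1
    · exact hbad _ (hQ 0 h0).2.2 (by linarith [hP 1 h1]) (hQ 0 h0).1
  · rcases le_total (g 0) (g 1) with h | h
    · exact hbad _ (hQ 1 h1).2.2 (by linarith [hP 2 h2]) (hQ 1 h1).1
    · exact hbad _ (hQ 0 h0).2.2 (by linarith [hP 2 h2]) (hQ 0 h0).1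

/-! ### Part C. Sorted directions: sets of triangle pairs and rhombus pairs -/

/-- **Four sorted directions.** Let `−π < t₀ < t₁ < t₂ < t₃ ≤ π` be four tangent directions at a
node, any two of which are a contact (`cos (tᵢ − tⱼ) = 1/3`) or separated (`cos (tᵢ − tⱼ) ≤ σ`,
`σ < 0`).  Let `P` be a set of *triangle pairs* (`cos = 1/3`) and `Q` a set of *rhombus pairs*
(`κ ≤ cos ≤ σ` with `κ > −7/9`) with `|P| + |Q| = 4`.  Then `(|P|, |Q|) = (1, 3)` or `(2, 2)`.
(The two diagonals `{0,2}`, `{1,3}` have cosine `≤ cos 2α = −7/9`, so `P, Q` consist of the four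
consecutive pairs, each of which is then a triangle gap `α` or an obtuse rhombus gap; conclude by
`card_filter_of_four_gaps`.) [cite: Hales2012, Lemma 7 (proof)] -/
theorem ncard_eq_of_sorted_four {σ κ : ℝ} (hσ : σ < 0) (hκ : -7 / 9 < κ) (t : Fin 4 → ℝ)
    (hmono : StrictMono t) (hlo : -π < t 0) (hhi : t 3 ≤ π)
    (hC : ∀ i j, i ≠ j → cos (t i - t j) = 1 / 3 ∨ cos (t i - t j) ≤ σ)
    (P Q : Set (Sym2 (Fin 4)))
    (hP : ∀ i j, s(i, j) ∈ P → i ≠ j ∧ cos (t i - t j) = 1 / 3)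
    (hQ : ∀ i j, s(i, j) ∈ Q → i ≠ j ∧ κ ≤ cos (t i - t j) ∧ cos (t i - t j) ≤ σ)
    (hpq : P.ncard + Q.ncard = 4) :
    P.ncard = 1 ∧ Q.ncard = 3 ∨ P.ncard = 2 ∧ Q.ncard = 2 := by
  classical
  have hα1 := pi_div_three_lt_arccos_third
  have hα2 := arccos_third_lt_pi_div_two
  have hπ := pi_pos
  have h01 : t 0 < t 1 := hmono (by decide)
  have h12 : t 1 < t 2 := hmono (by decide)
  have h23 : t 2 < t 3 := hmono (by decide)
  have hC' : ∀ i j, i ≠ j → cos (t i - t j) ≤ 1 / 3 := fun i j h => by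
    rcases hC i j h with h' | h' <;> linarith
  -- the four gaps (three consecutive, one wrap-around), each `≥ α = arccos (1/3)`
  have hg0 : arccos (1 / 3) ≤ t 1 - t 0 :=
    arccos_third_le_of_cos_le (by linarith) (hC' 1 0 (by decide))
  have hg1 : arccos (1 / 3) ≤ t 2 - t 1 :=
    arccos_third_le_of_cos_le (by linarith) (hC' 2 1 (by decide))
  have hg2 : arccos (1 / 3) ≤ t 3 - t 2 :=
    arccos_third_le_of_cos_le (by linarith) (hC' 3 2 (by decide))
  have hcw : cos (2 * π - (t 3 - t 0)) = cos (t 3 - t 0) := cos_two_pi_sub _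
  have hg3 : arccos (1 / 3) ≤ 2 * π - (t 3 - t 0) :=
    arccos_third_le_of_cos_le (by linarith) (by rw [hcw]; exact hC' 3 0 (by decide))
  -- the diagonals `{0, 2}` and `{1, 3}` have cosine `≤ -7/9`
  have hd20 : cos (t 2 - t 0) ≤ -7 / 9 := cos_le_neg_seven_ninths (by linarith) (by linarith)
  have hd31 : cos (t 3 - t 1) ≤ -7 / 9 := cos_le_neg_seven_ninths (by linarith) (by linarith)
  have hd02 : cos (t 0 - t 2) ≤ -7 / 9 := by rw [cos_sub_rev]; exact hd20
  have hd13 : cos (t 1 - t 3) ≤ -7 / 9 := by rw [cos_sub_rev]; exact hd31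
  -- hence `P` and `Q` consist of consecutive pairs
  set C : Finset (Sym2 (Fin 4)) := {s(0, 1), s(1, 2), s(2, 3), s(0, 3)} with hCdef
  have hCcard : C.card = 4 := by rw [hCdef]; decide
  have hmemC : ∀ i j : Fin 4, i ≠ j → -7 / 9 < cos (t i - t j) → s(i, j) ∈ C := by
    intro i j hne hcos
    fin_cases i <;> fin_cases j <;>
      simp only [Fin.zero_eta, Fin.mk_one, Fin.reduceFinMk] at hne hcos ⊢ <;>
      first
      | exact absurd rfl hne
      | (exfalso; linarith)
      | (rw [hCdef]; decide)
  have hPC : P ⊆ ↑C := by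
    intro z hz
    induction z using Sym2.ind with
    | h i j =>
      obtain ⟨hne, hcos⟩ := hP i j hz
      exact hmemC i j hne (by rw [hcos]; norm_num)
  have hQC : Q ⊆ ↑C := by
    intro z hz
    induction z using Sym2.ind with
    | h i j =>
      obtain ⟨hne, hκ', -⟩ := hQ i j hz
      exact hmemC i j hne (lt_of_lt_of_le hκ hκ')
  have hdisj : Disjoint P Q := by
    rw [Set.disjoint_left]
    intro z hzP hzQ
    induction z using Sym2.ind with
    | h i j =>
      obtain ⟨-, hcos⟩ := hP i j hzP
      obtain ⟨-, -, hle⟩ := hQ i j hzQ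
      linarith
  have hPfin : P.Finite := C.finite_toSet.subset hPC
  have hQfin : Q.Finite := C.finite_toSet.subset hQC
  have hU : P ∪ Q = ↑C :=
    Set.eq_of_subset_of_ncard_le (Set.union_subset hPC hQC)
      (by rw [Set.ncard_union_eq hdisj hPfin hQfin, hpq, Set.ncard_coe_finset, hCcard])
      C.finite_toSet
  have hcover : ∀ z ∈ C, z ∉ P → z ∈ Q := fun z hz hnP => by
    have h : z ∈ P ∪ Q := by rw [hU]; exact hz
    exact h.resolve_left hnP
  -- index the consecutive pairs and the gaps by `k : Fin 4`
  set c : Fin 4 → Sym2 (Fin 4) := ![s(0, 1), s(1, 2), s(2, 3), s(0, 3)] with hcdef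
  set g : Fin 4 → ℝ := ![t 1 - t 0, t 2 - t 1, t 3 - t 2, 2 * π - (t 3 - t 0)] with hgdef
  have hcC : ∀ z ∈ C, ∃ k, c k = z := by
    intro z hz
    simp only [hCdef, Finset.mem_insert, Finset.mem_singleton] at hz
    rcases hz with rfl | rfl | rfl | rfl
    exacts [⟨0, rfl⟩, ⟨1, rfl⟩, ⟨2, rfl⟩, ⟨3, rfl⟩]
  have hcmem : ∀ k, c k ∈ C := by
    intro k
    fin_cases k <;> simp [hcdef, hCdef]
  have hcinj : Function.Injective c := by rw [hcdef]; decide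
  have hPcount : P.ncard = (Finset.univ.filter fun k => c k ∈ P).card := by
    have hPeq : P = c '' {k | c k ∈ P} := by
      ext z
      constructor
      · intro hz
        obtain ⟨k, rfl⟩ := hcC z (hPC hz)
        exact ⟨k, hz, rfl⟩
      · rintro ⟨k, hk, rfl⟩
        exact hk
    calc P.ncard = (c '' {k | c k ∈ P}).ncard := by rw [← hPeq]
      _ = ({k | c k ∈ P} : Set (Fin 4)).ncard := Set.ncard_image_of_injective _ hcinj
      _ = (Finset.univ.filter fun k => c k ∈ P).card := by
        rw [← Set.ncard_coe_finset]; congr 1; ext k; simp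
  -- the gaps
  have hsum : g 0 + g 1 + g 2 + g 3 = 2 * π := by
    simp only [hgdef, Matrix.cons_val_zero, Matrix.cons_val_one, Matrix.cons_val]
    ring
  have hPgap : ∀ k, c k ∈ P → g k = arccos (1 / 3) := by
    intro k hk
    fin_cases k <;>
      simp only [hcdef, hgdef, Fin.zero_eta, Fin.mk_one, Fin.reduceFinMk, Matrix.cons_val_zero,
        Matrix.cons_val_one, Matrix.cons_val] at hk ⊢
    · obtain ⟨-, hcos⟩ := hP 0 1 hk
      exact eq_arccos_third_of_cos_eq (by linarith) (by linarith) (by rw [cos_sub_rev]; exact hcos)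
    · obtain ⟨-, hcos⟩ := hP 1 2 hk
      exact eq_arccos_third_of_cos_eq (by linarith) (by linarith) (by rw [cos_sub_rev]; exact hcos)
    · obtain ⟨-, hcos⟩ := hP 2 3 hk
      exact eq_arccos_third_of_cos_eq (by linarith) (by linarith) (by rw [cos_sub_rev]; exact hcos)
    · obtain ⟨-, hcos⟩ := hP 0 3 hk
      exact eq_arccos_third_of_cos_eq (by linarith) (by linarith)
        (by rw [hcw, cos_sub_rev]; exact hcos)
  have hQgap : ∀ k, ¬(c k ∈ P) → π / 2 < g k ∧ κ ≤ cos (g k) := by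
    intro k hk
    have hkQ : c k ∈ Q := hcover _ (hcmem k) hk
    fin_cases k <;>
      simp only [hcdef, hgdef, Fin.zero_eta, Fin.mk_one, Fin.reduceFinMk, Matrix.cons_val_zero,
        Matrix.cons_val_one, Matrix.cons_val] at hkQ ⊢
    · obtain ⟨-, h1, h2⟩ := hQ 0 1 hkQ
      rw [cos_sub_rev] at h1 h2
      exact ⟨pi_div_two_lt_of_cos_neg (by linarith) (by linarith), h1⟩
    · obtain ⟨-, h1, h2⟩ := hQ 1 2 hkQ
      rw [cos_sub_rev] at h1 h2
      exact ⟨pi_div_two_lt_of_cos_neg (by linarith) (by linarith), h1⟩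
    · obtain ⟨-, h1, h2⟩ := hQ 2 3 hkQ
      rw [cos_sub_rev] at h1 h2
      exact ⟨pi_div_two_lt_of_cos_neg (by linarith) (by linarith), h1⟩
    · obtain ⟨-, h1, h2⟩ := hQ 0 3 hkQ
      rw [cos_sub_rev, ← hcw] at h1 h2
      exact ⟨pi_div_two_lt_of_cos_neg (by linarith) (by linarith), h1⟩
  rcases card_filter_of_four_gaps hκ g (fun k => c k ∈ P) hsum hPgap hQgap with h | h
  · left
    constructor <;> omega
  · right
    constructor <;> omega

/-- **Three sorted directions.** With three directions `−π < t₀ < t₁ < t₂ ≤ π` (same conventions)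
and `|P| + |Q| = 3`, all three pairs are rhombus pairs: `(|P|, |Q|) = (0, 3)`.
[cite: Hales2012, Lemma 7 (proof)] -/
theorem ncard_eq_of_sorted_three {σ κ : ℝ} (hσ : σ < 0) (hκ : -7 / 9 < κ) (t : Fin 3 → ℝ)
    (hmono : StrictMono t) (hlo : -π < t 0) (hhi : t 2 ≤ π)
    (hC : ∀ i j, i ≠ j → cos (t i - t j) = 1 / 3 ∨ cos (t i - t j) ≤ σ)
    (P Q : Set (Sym2 (Fin 3)))
    (hP : ∀ i j, s(i, j) ∈ P → i ≠ j ∧ cos (t i - t j) = 1 / 3)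
    (hQ : ∀ i j, s(i, j) ∈ Q → i ≠ j ∧ κ ≤ cos (t i - t j) ∧ cos (t i - t j) ≤ σ)
    (hpq : P.ncard + Q.ncard = 3) :
    P.ncard = 0 ∧ Q.ncard = 3 := by
  classical
  have hα1 := pi_div_three_lt_arccos_third
  have hα2 := arccos_third_lt_pi_div_two
  have hπ := pi_pos
  have h01 : t 0 < t 1 := hmono (by decide)
  have h12 : t 1 < t 2 := hmono (by decide)
  have hC' : ∀ i j, i ≠ j → cos (t i - t j) ≤ 1 / 3 := fun i j h => by
    rcases hC i j h with h' | h' <;> linarith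
  -- the three gaps, each `≥ α`
  have hg0 : arccos (1 / 3) ≤ t 1 - t 0 :=
    arccos_third_le_of_cos_le (by linarith) (hC' 1 0 (by decide))
  have hg1 : arccos (1 / 3) ≤ t 2 - t 1 :=
    arccos_third_le_of_cos_le (by linarith) (hC' 2 1 (by decide))
  have hcw : cos (2 * π - (t 2 - t 0)) = cos (t 2 - t 0) := cos_two_pi_sub _
  have hg2 : arccos (1 / 3) ≤ 2 * π - (t 2 - t 0) :=
    arccos_third_le_of_cos_le (by linarith) (by rw [hcw]; exact hC' 2 0 (by decide))
  -- a gap that is a triangle or rhombus pair is `≤ π` (else its cosine is `≤ -7/9`)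
  have hle : ∀ x, arccos (1 / 3) ≤ x → x ≤ 2 * π - 2 * arccos (1 / 3) → -7 / 9 < cos x →
      x ≤ π := by
    intro x h1 h2 h3
    by_contra h
    have := cos_le_neg_seven_ninths (y := x) (by linarith) h2
    linarith
  -- all pairs are consecutive here
  set C : Finset (Sym2 (Fin 3)) := {s(0, 1), s(1, 2), s(0, 2)} with hCdef
  have hCcard : C.card = 3 := by rw [hCdef]; decide
  have hmemC : ∀ i j : Fin 3, i ≠ j → s(i, j) ∈ C := by
    intro i j hne
    fin_cases i <;> fin_cases j <;>
      simp only [Fin.zero_eta, Fin.mk_one, Fin.reduceFinMk] at hne ⊢ <;>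
      first
      | exact absurd rfl hne
      | (rw [hCdef]; decide)
  have hPC : P ⊆ ↑C := by
    intro z hz
    induction z using Sym2.ind with
    | h i j => exact hmemC i j (hP i j hz).1
  have hQC : Q ⊆ ↑C := by
    intro z hz
    induction z using Sym2.ind with
    | h i j => exact hmemC i j (hQ i j hz).1
  have hdisj : Disjoint P Q := by
    rw [Set.disjoint_left]
    intro z hzP hzQ
    induction z using Sym2.ind with
    | h i j =>
      obtain ⟨-, hcos⟩ := hP i j hzP
      obtain ⟨-, -, hle'⟩ := hQ i j hzQ
      linarith
  have hPfin : P.Finite := C.finite_toSet.subset hPC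
  have hQfin : Q.Finite := C.finite_toSet.subset hQC
  have hU : P ∪ Q = ↑C :=
    Set.eq_of_subset_of_ncard_le (Set.union_subset hPC hQC)
      (by rw [Set.ncard_union_eq hdisj hPfin hQfin, hpq, Set.ncard_coe_finset, hCcard])
      C.finite_toSet
  have hcover : ∀ z ∈ C, z ∉ P → z ∈ Q := fun z hz hnP => by
    have h : z ∈ P ∪ Q := by rw [hU]; exact hz
    exact h.resolve_left hnP
  set c : Fin 3 → Sym2 (Fin 3) := ![s(0, 1), s(1, 2), s(0, 2)] with hcdef
  set g : Fin 3 → ℝ := ![t 1 - t 0, t 2 - t 1, 2 * π - (t 2 - t 0)] with hgdef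
  have hcC : ∀ z ∈ C, ∃ k, c k = z := by
    intro z hz
    simp only [hCdef, Finset.mem_insert, Finset.mem_singleton] at hz
    rcases hz with rfl | rfl | rfl
    exacts [⟨0, rfl⟩, ⟨1, rfl⟩, ⟨2, rfl⟩]
  have hcmem : ∀ k, c k ∈ C := by
    intro k
    fin_cases k <;> simp [hcdef, hCdef]
  have hcinj : Function.Injective c := by rw [hcdef]; decide
  have hPcount : P.ncard = (Finset.univ.filter fun k => c k ∈ P).card := by
    have hPeq : P = c '' {k | c k ∈ P} := by
      ext z
      constructor
      · intro hz
        obtain ⟨k, rfl⟩ := hcC z (hPC hz)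
        exact ⟨k, hz, rfl⟩
      · rintro ⟨k, hk, rfl⟩
        exact hk
    calc P.ncard = (c '' {k | c k ∈ P}).ncard := by rw [← hPeq]
      _ = ({k | c k ∈ P} : Set (Fin 3)).ncard := Set.ncard_image_of_injective _ hcinj
      _ = (Finset.univ.filter fun k => c k ∈ P).card := by
        rw [← Set.ncard_coe_finset]; congr 1; ext k; simp
  have hsum : g 0 + g 1 + g 2 = 2 * π := by
    simp only [hgdef, Matrix.cons_val_zero, Matrix.cons_val_one, Matrix.cons_val]
    ring
  have hPgap : ∀ k, c k ∈ P → g k = arccos (1 / 3) := by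
    intro k hk
    fin_cases k <;>
      simp only [hcdef, hgdef, Fin.zero_eta, Fin.mk_one, Fin.reduceFinMk, Matrix.cons_val_zero,
        Matrix.cons_val_one, Matrix.cons_val] at hk ⊢
    · obtain ⟨-, hcos⟩ := hP 0 1 hk
      rw [cos_sub_rev] at hcos
      exact eq_arccos_third_of_cos_eq (by linarith)
        (hle _ hg0 (by linarith) (by rw [hcos]; norm_num)) hcos
    · obtain ⟨-, hcos⟩ := hP 1 2 hk
      rw [cos_sub_rev] at hcos
      exact eq_arccos_third_of_cos_eq (by linarith)
        (hle _ hg1 (by linarith) (by rw [hcos]; norm_num)) hcos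
    · obtain ⟨-, hcos⟩ := hP 0 2 hk
      rw [cos_sub_rev, ← hcw] at hcos
      exact eq_arccos_third_of_cos_eq (by linarith)
        (hle _ hg2 (by linarith) (by rw [hcos]; norm_num)) hcos
  have hQgap : ∀ k, ¬(c k ∈ P) → g k ≤ π ∧ π / 2 < g k ∧ κ ≤ cos (g k) := by
    intro k hk
    have hkQ : c k ∈ Q := hcover _ (hcmem k) hk
    fin_cases k <;>
      simp only [hcdef, hgdef, Fin.zero_eta, Fin.mk_one, Fin.reduceFinMk, Matrix.cons_val_zero,
        Matrix.cons_val_one, Matrix.cons_val] at hkQ ⊢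
    · obtain ⟨-, h1, h2⟩ := hQ 0 1 hkQ
      rw [cos_sub_rev] at h1 h2
      exact ⟨hle _ hg0 (by linarith) (by linarith),
        pi_div_two_lt_of_cos_neg (by linarith) (by linarith), h1⟩
    · obtain ⟨-, h1, h2⟩ := hQ 1 2 hkQ
      rw [cos_sub_rev] at h1 h2
      exact ⟨hle _ hg1 (by linarith) (by linarith),
        pi_div_two_lt_of_cos_neg (by linarith) (by linarith), h1⟩
    · obtain ⟨-, h1, h2⟩ := hQ 0 2 hkQ
      rw [cos_sub_rev, ← hcw] at h1 h2
      exact ⟨hle _ hg2 (by linarith) (by linarith),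
        pi_div_two_lt_of_cos_neg (by linarith) (by linarith), h1⟩
  have h := card_filter_of_three_gaps hκ g (fun k => c k ∈ P) hsum hPgap hQgap
  constructor <;> omega

/-- **Two directions** cannot carry `|P| + |Q| = 2` (there is only one pair, and a pair is not
both a triangle and a rhombus pair). [cite: Hales2012, Lemma 7 (proof)] -/
theorem false_of_sorted_two {σ κ : ℝ} (hσ : σ < 0) (t : Fin 2 → ℝ)
    (P Q : Set (Sym2 (Fin 2)))
    (hP : ∀ i j, s(i, j) ∈ P → i ≠ j ∧ cos (t i - t j) = 1 / 3)
    (hQ : ∀ i j, s(i, j) ∈ Q → i ≠ j ∧ κ ≤ cos (t i - t j) ∧ cos (t i - t j) ≤ σ)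
    (hpq : P.ncard + Q.ncard = 2) : False := by
  have hsub : P ∪ Q ⊆ {s(0, 1)} := by
    intro z hz
    induction z using Sym2.ind with
    | h i j =>
      have hne : i ≠ j := by
        rcases hz with hz | hz
        exacts [(hP i j hz).1, (hQ i j hz).1]
      show s(i, j) = s(0, 1)
      fin_cases i <;> fin_cases j <;>
        simp only [Fin.zero_eta, Fin.mk_one] at hne ⊢ <;>
        first
        | exact absurd rfl hne
        | decide
  have hdisj : Disjoint P Q := by
    rw [Set.disjoint_left]
    intro z hzP hzQ
    induction z using Sym2.ind with
    | h i j =>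
      obtain ⟨-, hcos⟩ := hP i j hzP
      obtain ⟨-, -, hle⟩ := hQ i j hzQ
      linarith
  have hfin : ({s(0, 1)} : Set (Sym2 (Fin 2))).Finite := Set.finite_singleton _
  have h1 : (P ∪ Q).ncard ≤ 1 := by
    rw [← Set.ncard_singleton (s(0, 1) : Sym2 (Fin 2))]
    exact Set.ncard_le_ncard hsub hfin
  rw [Set.ncard_union_eq hdisj (hfin.subset ((Set.subset_union_left).trans hsub))
    (hfin.subset ((Set.subset_union_right).trans hsub))] at h1
  omega

/-- **One direction** cannot carry `|P| + |Q| = 1` (there are no pairs at all).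
[cite: Hales2012, Lemma 7 (proof)] -/
theorem false_of_sorted_one {σ κ : ℝ} (t : Fin 1 → ℝ) (P Q : Set (Sym2 (Fin 1)))
    (hP : ∀ i j, s(i, j) ∈ P → i ≠ j ∧ cos (t i - t j) = 1 / 3)
    (hQ : ∀ i j, s(i, j) ∈ Q → i ≠ j ∧ κ ≤ cos (t i - t j) ∧ cos (t i - t j) ≤ σ)
    (hpq : P.ncard + Q.ncard = 1) : False := by
  have hPe : P = ∅ := by
    ext z
    simp only [Set.mem_empty_iff_false, iff_false]
    intro hz
    induction z using Sym2.ind with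
    | h i j => exact (hP i j hz).1 (Subsingleton.elim i j)
  have hQe : Q = ∅ := by
    ext z
    simp only [Set.mem_empty_iff_false, iff_false]
    intro hz
    induction z using Sym2.ind with
    | h i j => exact (hQ i j hz).1 (Subsingleton.elim i j)
  rw [hPe, hQe, Set.ncard_empty] at hpq
  omega

/-! ### Part D. Tangent angles at a node of `S²(2)`: Hales's angle table (7) -/

open RealInnerProductSpace

/-- The **tangent (azimuth) angle** of a point `u` in an orthonormal frame `b` of `ℝ³`: the argument
of `⟪b₀, u⟫ + i ⟪b₁, u⟫`.  For a frame with `b₂ = v/2` and contacts `u, u'` of `v ∈ S²(2)`, the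
difference of tangent angles is Hales's dihedral angle `dih` of the simplex `{0, v, u, u'}` along
`{0, v}` (the angle `azim (0, v, u, u')` of *Dense Sphere Packings*, used on p. 3 to define the
node permutation `σ(v)`). [cite: Hales2012, §2 (azimuth angle, p. 3)] -/
def tangentArg (b : OrthonormalBasis (Fin 3) ℝ (EuclideanSpace ℝ (Fin 3)))
    (u : EuclideanSpace ℝ (Fin 3)) : ℝ :=
  Complex.arg ⟨⟪b 0, u⟫, ⟪b 1, u⟫⟩

/-- Unfolding `tangentArg`. [folklore] -/
theorem tangentArg_def (b : OrthonormalBasis (Fin 3) ℝ (EuclideanSpace ℝ (Fin 3)))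
    (u : EuclideanSpace ℝ (Fin 3)) : tangentArg b u = Complex.arg ⟨⟪b 0, u⟫, ⟪b 1, u⟫⟩ := rfl

/-- The tangent angle lies in `(−π, π]`. [folklore] -/
theorem neg_pi_lt_tangentArg (b : OrthonormalBasis (Fin 3) ℝ (EuclideanSpace ℝ (Fin 3)))
    (u : EuclideanSpace ℝ (Fin 3)) : -π < tangentArg b u ∧ tangentArg b u ≤ π :=
  ⟨Complex.neg_pi_lt_arg _, Complex.arg_le_pi _⟩

/-- **Tangent coordinates of a contact.** In a frame `b` with `b₂ = v/2` (`‖v‖ = 2`), a contact `u`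
of `v` (`‖u‖ = 2`, `‖u − v‖ = 2`) has coordinates `(X, Y, 1)` with `X² + Y² = 3`. [folklore] -/
theorem tangent_coords {v u : EuclideanSpace ℝ (Fin 3)} (hv : ‖v‖ = 2)
    (b : OrthonormalBasis (Fin 3) ℝ (EuclideanSpace ℝ (Fin 3))) (hb : b 2 = (1 / 2 : ℝ) • v)
    (hu : ‖u‖ = 2) (hd : dist u v = 2) : ⟪b 2, u⟫ = 1 ∧ ⟪b 0, u⟫ ^ 2 + ⟪b 1, u⟫ ^ 2 = 3 := by
  have hZ : ⟪b 2, u⟫ = 1 := by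
    rw [hb, real_inner_smul_left, real_inner_comm, inner_eq_two_of_dist_eq_two hu hv hd]
    norm_num
  refine ⟨hZ, ?_⟩
  have h4 : ⟪u, u⟫ = 4 := by
    rw [real_inner_self_eq_norm_sq, hu]; norm_num
  rw [inner_eq_sum_three b, hZ] at h4
  nlinarith [h4]

/-- **Inner product of two contacts of `v` through their tangent angles**:
`⟪u, w⟫ = 1 + 3 cos (θ_u − θ_w)`; equivalently `‖u − w‖² = 6 − 6 cos (θ_u − θ_w)`. [folklore] -/
theorem inner_eq_one_add_three_mul_cos {v u w : EuclideanSpace ℝ (Fin 3)} (hv : ‖v‖ = 2)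
    (b : OrthonormalBasis (Fin 3) ℝ (EuclideanSpace ℝ (Fin 3))) (hb : b 2 = (1 / 2 : ℝ) • v)
    (hu : ‖u‖ = 2) (hdu : dist u v = 2) (hw : ‖w‖ = 2) (hdw : dist w v = 2) :
    ⟪u, w⟫ = 1 + 3 * cos (tangentArg b u - tangentArg b w) := by
  obtain ⟨hZu, hXYu⟩ := tangent_coords hv b hb hu hdu
  obtain ⟨hZw, hXYw⟩ := tangent_coords hv b hb hw hdw
  have hc := mul_add_mul_eq_three_mul_cos hXYu hXYw
  rw [inner_eq_sum_three b, hZu, hZw, tangentArg_def, tangentArg_def]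
  linarith [hc]

/-- The squared distance of two contacts of `v`: `‖u − w‖² = 6 − 6 cos (θ_u − θ_w)`. [folklore] -/
theorem dist_sq_eq_of_contacts {v u w : EuclideanSpace ℝ (Fin 3)} (hv : ‖v‖ = 2)
    (b : OrthonormalBasis (Fin 3) ℝ (EuclideanSpace ℝ (Fin 3))) (hb : b 2 = (1 / 2 : ℝ) • v)
    (hu : ‖u‖ = 2) (hdu : dist u v = 2) (hw : ‖w‖ = 2) (hdw : dist w v = 2) :
    dist u w ^ 2 = 6 - 6 * cos (tangentArg b u - tangentArg b w) := by
  rw [dist_eq_norm, norm_sub_sq_real, hu, hw, inner_eq_one_add_three_mul_cos hv b hb hu hdu hw hdw]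
  ring

/-- Two contacts of `v` with the same tangent angle coincide. [folklore] -/
theorem eq_of_tangentArg_eq {v u w : EuclideanSpace ℝ (Fin 3)} (hv : ‖v‖ = 2)
    (b : OrthonormalBasis (Fin 3) ℝ (EuclideanSpace ℝ (Fin 3))) (hb : b 2 = (1 / 2 : ℝ) • v)
    (hu : ‖u‖ = 2) (hdu : dist u v = 2) (hw : ‖w‖ = 2) (hdw : dist w v = 2)
    (h : tangentArg b u = tangentArg b w) : u = w := by
  obtain ⟨hZu, hXYu⟩ := tangent_coords hv b hb hu hdu
  obtain ⟨hZw, hXYw⟩ := tangent_coords hv b hb hw hdw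
  obtain ⟨hXu, hYu⟩ := eq_sqrt_three_mul_cos_sin_arg hXYu
  obtain ⟨hXw, hYw⟩ := eq_sqrt_three_mul_cos_sin_arg hXYw
  rw [tangentArg_def, tangentArg_def] at h
  refine eq_of_inner_basis_eq b fun m => ?_
  fin_cases m
  · show ⟪b 0, u⟫ = ⟪b 0, w⟫
    rw [hXu, hXw, h]
  · show ⟪b 1, u⟫ = ⟪b 1, w⟫
    rw [hYu, hYw, h]
  · show ⟪b 2, u⟫ = ⟪b 2, w⟫
    rw [hZu, hZw]

/-- **Table (7), `k = 3`: a triangle corner is `α₃ = β₃ = dih(2,2,2,2,2,2) = arccos (1/3)`.**  Two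
contacts `u, w` of `v` at distance `2` from each other have tangent angles differing by the
dihedral angle of the regular tetrahedron: `cos (θ_u − θ_w) = 1/3`.
[cite: Hales2012, Lemma 7 (proof, table (7))] -/
theorem cos_tangentArg_sub_eq_third {v u w : EuclideanSpace ℝ (Fin 3)} (hv : ‖v‖ = 2)
    (b : OrthonormalBasis (Fin 3) ℝ (EuclideanSpace ℝ (Fin 3))) (hb : b 2 = (1 / 2 : ℝ) • v)
    (hu : ‖u‖ = 2) (hdu : dist u v = 2) (hw : ‖w‖ = 2) (hdw : dist w v = 2) (h : dist u w = 2) :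
    cos (tangentArg b u - tangentArg b w) = 1 / 3 := by
  have hsq := dist_sq_eq_of_contacts hv b hb hu hdu hw hdw
  rw [h] at hsq
  linarith

/-- **Table (7), `k ≥ 4`, lower bound `α₄ = α₅ = dih(2,2,2,2h₀,2,2)`.**  Two contacts `u, w` of `v`
at distance `≥ 2h₀` from each other have `cos (θ_u − θ_w) ≤ 1 − (2h₀)²/6 = cos α₄ ≈ −0.0584`.
[cite: Hales2012, Lemma 7 (proof, table (7))] -/
theorem cos_tangentArg_sub_le_of_separated {v u w : EuclideanSpace ℝ (Fin 3)} (hv : ‖v‖ = 2)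
    (b : OrthonormalBasis (Fin 3) ℝ (EuclideanSpace ℝ (Fin 3))) (hb : b 2 = (1 / 2 : ℝ) • v)
    (hu : ‖u‖ = 2) (hdu : dist u v = 2) (hw : ‖w‖ = 2) (hdw : dist w v = 2)
    (h : 2 * hales_h0 ≤ dist u w) :
    cos (tangentArg b u - tangentArg b w) ≤ 1 - (2 * hales_h0) ^ 2 / 6 := by
  have hsq := dist_sq_eq_of_contacts hv b hb hu hdu hw hdw
  have h0 : 0 ≤ 2 * hales_h0 := by rw [hales_h0_eq]; norm_num
  have h2 : (2 * hales_h0) ^ 2 ≤ dist u w ^ 2 := pow_le_pow_left₀ h0 h 2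
  rw [hsq] at h2
  linarith

/-- **Table (7), `k = 4`, upper bound `β₄ = 2 dih(2,2,2,2,2h₀,2)` (the rhombus bound).**  Let `u ≠ w`
be contacts of `v`, and let `x ≠ v` be a second common contact of `u` and `w` at distance `≥ 2h₀`
from `v` (a rhombus `v, u, x, w` of side `2` on `S²(2)`).  By the rhombus lemma
(`rhombus_smul_add_eq`: `x` is the mirror image of `v` in the plane of `0, u, w`, and
`(4 + ⟪u, w⟫)(4 + ⟪v, x⟫) = 16`), `⟪v, x⟫ ≤ 4 − 2h₀²` gives
`cos (θ_u − θ_w) ≥ (5h₀² − 12)/(3(4 − h₀²)) = cos β₄ ≈ −0.5613`.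
[cite: Hales2012, Lemma 7 (proof, table (7))] -/
theorem le_cos_tangentArg_sub_of_rhombus {v u w x : EuclideanSpace ℝ (Fin 3)} (hv : ‖v‖ = 2)
    (b : OrthonormalBasis (Fin 3) ℝ (EuclideanSpace ℝ (Fin 3))) (hb : b 2 = (1 / 2 : ℝ) • v)
    (hu : ‖u‖ = 2) (hw : ‖w‖ = 2) (hx : ‖x‖ = 2) (hdu : dist u v = 2) (hdw : dist w v = 2)
    (huw : u ≠ w) (hxv : x ≠ v) (hsep : 2 * hales_h0 ≤ dist x v) (hxu : dist x u = 2)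
    (hxw : dist x w = 2) :
    (5 * hales_h0 ^ 2 - 12) / (3 * (4 - hales_h0 ^ 2)) ≤ cos (tangentArg b u - tangentArg b w) := by
  have n4 : ∀ y : EuclideanSpace ℝ (Fin 3), ‖y‖ = 2 → ⟪y, y⟫ = 4 := fun y hy => by
    rw [real_inner_self_eq_norm_sq, hy]; norm_num
  have hvu : ⟪v, u⟫ = 2 := by rw [real_inner_comm]; exact inner_eq_two_of_dist_eq_two hu hv hdu
  have hvw : ⟪v, w⟫ = 2 := by rw [real_inner_comm]; exact inner_eq_two_of_dist_eq_two hw hv hdw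
  have hxu' : ⟪x, u⟫ = 2 := inner_eq_two_of_dist_eq_two hx hu hxu
  have hxw' : ⟪x, w⟫ = 2 := inner_eq_two_of_dist_eq_two hx hw hxw
  have hR := rhombus_smul_add_eq (n4 v hv) (n4 u hu) (n4 x hx) (n4 w hw) hvu hvw hxu' hxw'
    (Ne.symm hxv) huw
  have hprod : (4 + ⟪u, w⟫) * (4 + ⟪v, x⟫) = 16 := rhombus_inner_mul_eq (n4 v hv) hvu hvw hR
  -- `⟪v, x⟫ ≤ 4 - 2 h₀²` from the separation `‖x - v‖ ≥ 2h₀`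
  have hvx : ⟪v, x⟫ ≤ 4 - 2 * hales_h0 ^ 2 := by
    have h0 : 0 ≤ 2 * hales_h0 := by rw [hales_h0_eq]; norm_num
    have h2 : (2 * hales_h0) ^ 2 ≤ dist x v ^ 2 := pow_le_pow_left₀ h0 hsep 2
    rw [dist_eq_norm, norm_sub_sq_real, hx, hv, real_inner_comm] at h2
    nlinarith [h2]
  -- `4 + ⟪u, w⟫ ≥ 0` (Cauchy–Schwarz)
  have hA : 0 ≤ 4 + ⟪u, w⟫ := by
    have h1 := abs_real_inner_le_norm u w
    rw [hu, hw] at h1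
    have h2 := neg_abs_le ⟪u, w⟫
    linarith
  have hkey : 16 ≤ (4 + ⟪u, w⟫) * (8 - 2 * hales_h0 ^ 2) := by
    nlinarith [mul_nonneg hA (sub_nonneg.2 hvx)]
  rw [inner_eq_one_add_three_mul_cos hv b hb hu hdu hw hdw] at hkey
  have hden : 0 < 3 * (4 - hales_h0 ^ 2) := by rw [hales_h0_eq]; norm_num
  rw [div_le_iff₀ hden]
  nlinarith [hkey]

/-- Numerics of the two thresholds (`h₀ = 1.26`): `cos α₄ = 1 − (2h₀)²/6 = −0.0584 < 0` (a corner
between separated contacts is obtuse) and `cos β₄ = (5h₀² − 12)/(3(4 − h₀²)) ≈ −0.5613 > −7/9 =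
cos 2α₃` (a rhombus corner is narrower than two triangle corners). [cite: Hales2012, Lemma 7
(proof, table (7))] -/
theorem node_type_thresholds :
    1 - (2 * hales_h0) ^ 2 / 6 < 0 ∧
      -7 / 9 < (5 * hales_h0 ^ 2 - 12) / (3 * (4 - hales_h0 ^ 2)) := by
  rw [hales_h0_eq]
  constructor <;> norm_num

/-! ### Part E. Triangle pairs and rhombus pairs at a node of the contact graph -/

/-- **The triangle pairs at a node `v`** of the contact graph of `S`: the contact pairs `{u, w}`
of neighbours of `v` — equivalently, the triangles `{v, u, w}` of the contact graph through `v`.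
For `V ∈ 𝒱` these are exactly the triangular faces of `hyp(V, E₂(V))` at `v` (two contacts of `v`
in contact make the minimal tangent angle `α₃` at `v`, so they are azimuthally consecutive); their
number is the entry `p` of the type `(p, q, r)` of the node `v`. [cite: Hales2012, §6 (type of a
node), Lemma 7] -/
def trianglePairs (S : Set (EuclideanSpace ℝ (Fin 3))) (v : S) : Set (Sym2 S) :=
  {e | e ∈ (contactGraph S).edgeSet ∧ ∀ u ∈ e, (contactGraph S).Adj v u}

/-- **The rhombus pairs at a node `v`** of the contact graph of `S`: the pairs `{u, w}` of distinct,
non-contact neighbours of `v` having a second common contact `x ≠ v` that is not a contact of `v` —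
so that `v, u, x, w` is a spherical rhombus of side `2` (a quadrilateral face of the contact
hypermap at `v`: `x` is the mirror image of `v` in the plane of `0, u, w`, the corner at `v` is at
most `β₄ < 2α₃`, hence `u, w` are azimuthally consecutive).  Their number is the entry `q` of the
type `(p, q, r)` of `v`.  (The condition that `x` is not a contact of `v` excludes the pair of
outer contacts of two adjacent triangles `{v, u, x}, {v, x, w}`, which is not a face.)
[cite: Hales2012, §6 (type of a node), Lemma 7] -/
def rhombusPairs (S : Set (EuclideanSpace ℝ (Fin 3))) (v : S) : Set (Sym2 S) :=
  {e | ¬e.IsDiag ∧ e ∉ (contactGraph S).edgeSet ∧ (∀ u ∈ e, (contactGraph S).Adj v u) ∧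
    ∃ x : S, x ≠ v ∧ ¬(contactGraph S).Adj v x ∧ ∀ u ∈ e, (contactGraph S).Adj x u}

/-- Membership of a pair in `trianglePairs`. [folklore] -/
@[simp] theorem mk_mem_trianglePairs {S : Set (EuclideanSpace ℝ (Fin 3))} {v u w : S} :
    s(u, w) ∈ trianglePairs S v ↔
      (contactGraph S).Adj u w ∧ (contactGraph S).Adj v u ∧ (contactGraph S).Adj v w := by
  simp only [trianglePairs, Set.mem_setOf_eq, SimpleGraph.mem_edgeSet, Sym2.forall_mem_pair]

/-- Membership of a pair in `rhombusPairs`. [folklore] -/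
@[simp] theorem mk_mem_rhombusPairs {S : Set (EuclideanSpace ℝ (Fin 3))} {v u w : S} :
    s(u, w) ∈ rhombusPairs S v ↔
      u ≠ w ∧ ¬(contactGraph S).Adj u w ∧ ((contactGraph S).Adj v u ∧ (contactGraph S).Adj v w) ∧
        ∃ x : S, x ≠ v ∧ ¬(contactGraph S).Adj v x ∧
          (contactGraph S).Adj x u ∧ (contactGraph S).Adj x w := by
  simp only [rhombusPairs, Set.mem_setOf_eq, SimpleGraph.mem_edgeSet, Sym2.forall_mem_pair,
    Sym2.mk_isDiag_iff]

/-- Triangle pairs consist of neighbours of `v`. [folklore] -/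
theorem mem_neighborSet_of_mem_trianglePairs {S : Set (EuclideanSpace ℝ (Fin 3))} {v : S}
    {z : Sym2 S} (hz : z ∈ trianglePairs S v) {u : S} (hu : u ∈ z) :
    u ∈ (contactGraph S).neighborSet v :=
  hz.2 u hu

/-- Rhombus pairs consist of neighbours of `v`. [folklore] -/
theorem mem_neighborSet_of_mem_rhombusPairs {S : Set (EuclideanSpace ℝ (Fin 3))} {v : S}
    {z : Sym2 S} (hz : z ∈ rhombusPairs S v) {u : S} (hu : u ∈ z) :
    u ∈ (contactGraph S).neighborSet v :=
  hz.2.2.1 u hu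

/-- Triangle pairs and rhombus pairs are disjoint. [folklore] -/
theorem disjoint_trianglePairs_rhombusPairs (S : Set (EuclideanSpace ℝ (Fin 3))) (v : S) :
    Disjoint (trianglePairs S v) (rhombusPairs S v) :=
  Set.disjoint_left.2 fun _ hT hR => hR.2.1 hT.1

/-! ### Part F. Sorting the neighbours by tangent angle; transfer of pair counts -/

/-- **Sorted enumeration.** A finite set on which a real function `θ` is injective is the range of
an enumeration `e : Fin d → ι` along which `θ` is strictly increasing. [folklore] -/
theorem exists_sorted_enum {ι : Type*} (θ : ι → ℝ) {N : Set ι} (hfin : N.Finite)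
    (hinj : Set.InjOn θ N) {d : ℕ} (hd : N.ncard = d) :
    ∃ e : Fin d → ι, StrictMono (θ ∘ e) ∧ Set.range e = N := by
  classical
  set A : Finset ℝ := hfin.toFinset.image θ with hA
  have hAcard : A.card = d := by
    rw [hA, Finset.card_image_of_injOn (by simpa using hinj), ← Set.ncard_eq_toFinset_card N hfin,
      hd]
  set f := A.orderEmbOfFin hAcard with hf
  have hmem : ∀ k, ∃ u ∈ N, θ u = f k := by
    intro k
    have hk : f k ∈ A := A.orderEmbOfFin_mem hAcard k
    rw [hA, Finset.mem_image] at hk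
    obtain ⟨u, hu, hu'⟩ := hk
    exact ⟨u, by simpa using hu, hu'⟩
  choose e heN heθ using hmem
  refine ⟨e, fun i j hij => ?_, ?_⟩
  · show θ (e i) < θ (e j)
    rw [heθ, heθ]
    exact f.strictMono hij
  · ext u
    constructor
    · rintro ⟨k, rfl⟩
      exact heN k
    · intro hu
      have hu' : θ u ∈ Set.range f := by
        rw [hf, Finset.range_orderEmbOfFin, hA, Finset.coe_image]
        exact ⟨u, by simpa using hu, rfl⟩
      obtain ⟨k, hk⟩ := hu'
      exact ⟨k, hinj (heN k) hu (by rw [heθ, hk])⟩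

/-- **Transfer of pair counts along an injective enumeration.** If every element of every pair in
`R ⊆ Sym2 β` lies in the range of the injection `e : α → β`, then `|R|` equals the number of
pairs of indices mapping into `R`. [folklore] -/
theorem ncard_eq_ncard_preimage_sym2Map {α β : Type*} {e : α → β} (hinj : Function.Injective e)
    {R : Set (Sym2 β)} (hR : ∀ z ∈ R, ∀ b ∈ z, b ∈ Set.range e) :
    R.ncard = (Sym2.map e ⁻¹' R).ncard := by
  have hsub : R ⊆ Set.range (Sym2.map e) := by
    intro z hz
    induction z using Sym2.ind with
    | h a b =>
      obtain ⟨i, hi⟩ := hR _ hz a (Sym2.mem_mk_left a b)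
      obtain ⟨j, hj⟩ := hR _ hz b (Sym2.mem_mk_right a b)
      exact ⟨s(i, j), by rw [Sym2.map_mk, hi, hj]⟩
  conv_lhs => rw [← Set.image_preimage_eq_of_subset hsub]
  exact Set.ncard_image_of_injective _ (Sym2.map.injective hinj)

/-! ### Part G. Hales 2012, Lemma 7 (second assertion): node types -/

/-- **Hales 2012, Lemma 7 (second assertion): "suppose the type of a node is `(p, q, 0)`. Then
`(p, q)` must be `(0, 3)`, `(1, 3)`, or `(2, 2)`."**  Local, hypermap-free form for a kissing
configuration `S` (Definition 1) and a node `v` of its contact graph: let `p = |trianglePairs S v|`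
(contact pairs of neighbours of `v` = triangular faces at `v`) and `q = |rhombusPairs S v|`
(rhombus pairs = quadrilateral faces at `v`).  If every corner at `v` is a triangle or a rhombus
corner — `p + q = deg v` (the `deg v ≥ 1` corners at `v` are the pairs of azimuthally consecutive
neighbours, and triangle/rhombus pairs are automatically consecutive) — then
`(p, q) ∈ {(0, 3), (1, 3), (2, 2)}`.  Proof as printed: a triangle corner is `α₃ = arccos (1/3)`,
a rhombus corner lies in `[α₄, β₄]` with `α₄ > π/2` and `β₄ < 2α₃`, and the corners sum to `2π`
(Parts B–D; `deg v ≤ 4` by `KissingNodeDegree`). [cite: Hales2012, Lemma 7] -/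
theorem IsKissingConfig.node_type {S : Set (EuclideanSpace ℝ (Fin 3))} (hS : IsKissingConfig S)
    (v : S)
    (hpq : (trianglePairs S v).ncard + (rhombusPairs S v).ncard =
      ((contactGraph S).neighborSet v).ncard)
    (hne : ((contactGraph S).neighborSet v).Nonempty) :
    (trianglePairs S v).ncard = 0 ∧ (rhombusPairs S v).ncard = 3 ∨
      (trianglePairs S v).ncard = 1 ∧ (rhombusPairs S v).ncard = 3 ∨
        (trianglePairs S v).ncard = 2 ∧ (rhombusPairs S v).ncard = 2 := by
  classical
  obtain ⟨hσ, hκ⟩ := node_type_thresholds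
  set σ₀ : ℝ := 1 - (2 * hales_h0) ^ 2 / 6 with hσ₀
  set κ₀ : ℝ := (5 * hales_h0 ^ 2 - 12) / (3 * (4 - hales_h0 ^ 2)) with hκ₀
  set G := contactGraph S with hG
  set N := G.neighborSet v with hN
  have hv : ‖(v : EuclideanSpace ℝ (Fin 3))‖ = 2 := hS.norm_eq v.2
  obtain ⟨b, hb⟩ := exists_orthonormalBasis_third_eq hv
  set θ : S → ℝ := fun u => tangentArg b u with hθ
  have hNdist : ∀ u : S, u ∈ N → dist (u : EuclideanSpace ℝ (Fin 3)) v = 2 := fun u hu => by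
    rw [hN, SimpleGraph.mem_neighborSet, hG, contactGraph_adj] at hu
    rwa [dist_comm]
  haveI : Finite S := hS.finite.to_subtype
  have hNfin : N.Finite := Set.toFinite N
  have hinjN : Set.InjOn θ N := fun u hu w hw h =>
    Subtype.ext (eq_of_tangentArg_eq hv b hb (hS.norm_eq u.2) (hNdist u hu) (hS.norm_eq w.2)
      (hNdist w hw) h)
  have hd4 : N.ncard ≤ 4 := hS.ncard_neighborSet_le_four v
  have hd0 : N.ncard ≠ 0 := by
    rw [Ne, Set.ncard_eq_zero hNfin]
    exact hne.ne_empty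
  -- facts along an injective enumeration of the neighbours
  have hfacts : ∀ {d : ℕ} (e : Fin d → S), Set.range e = N → Function.Injective e →
      (∀ i j, i ≠ j → cos (θ (e i) - θ (e j)) = 1 / 3 ∨ cos (θ (e i) - θ (e j)) ≤ σ₀) ∧
      (∀ i j, s(i, j) ∈ Sym2.map e ⁻¹' trianglePairs S v →
        i ≠ j ∧ cos (θ (e i) - θ (e j)) = 1 / 3) ∧
      (∀ i j, s(i, j) ∈ Sym2.map e ⁻¹' rhombusPairs S v →
        i ≠ j ∧ κ₀ ≤ cos (θ (e i) - θ (e j)) ∧ cos (θ (e i) - θ (e j)) ≤ σ₀) := by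
    intro d e hrange hinj
    have hmemN : ∀ i, e i ∈ N := fun i => hrange ▸ Set.mem_range_self i
    have hdv : ∀ i, dist (e i : EuclideanSpace ℝ (Fin 3)) v = 2 := fun i => hNdist _ (hmemN i)
    have hn2 : ∀ i, ‖(e i : EuclideanSpace ℝ (Fin 3))‖ = 2 := fun i => hS.norm_eq (e i).2
    have hsepij : ∀ i j, e i ≠ e j → ¬G.Adj (e i) (e j) →
        2 * hales_h0 ≤ dist (e i : EuclideanSpace ℝ (Fin 3)) (e j) := by
      intro i j hne hnadj
      rcases hS.2.2 _ (e i).2 _ (e j).2 with h | h | h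
      · exact absurd (Subtype.ext h) hne
      · exact absurd h hnadj
      · exact h
    refine ⟨fun i j hij => ?_, fun i j hij => ?_, fun i j hij => ?_⟩
    · have hne : e i ≠ e j := fun h => hij (hinj h)
      by_cases hadj : G.Adj (e i) (e j)
      · exact Or.inl (cos_tangentArg_sub_eq_third hv b hb (hn2 i) (hdv i) (hn2 j) (hdv j) hadj)
      · exact Or.inr (cos_tangentArg_sub_le_of_separated hv b hb (hn2 i) (hdv i) (hn2 j) (hdv j)
          (hsepij i j hne hadj))
    · rw [Set.mem_preimage, Sym2.map_mk, mk_mem_trianglePairs] at hij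
      obtain ⟨huw, -, -⟩ := hij
      exact ⟨fun h => G.ne_of_adj huw (congrArg e h),
        cos_tangentArg_sub_eq_third hv b hb (hn2 i) (hdv i) (hn2 j) (hdv j) huw⟩
    · rw [Set.mem_preimage, Sym2.map_mk, mk_mem_rhombusPairs] at hij
      obtain ⟨hne, hnadj, -, x, hxv, hxnadj, hxu, hxw⟩ := hij
      have hxv' : (x : EuclideanSpace ℝ (Fin 3)) ≠ v := fun h => hxv (Subtype.ext h)
      have hsep : 2 * hales_h0 ≤ dist (x : EuclideanSpace ℝ (Fin 3)) v := by
        rcases hS.2.2 _ x.2 _ v.2 with h | h | h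
        · exact absurd h hxv'
        · exact absurd (by rw [contactGraph_adj, dist_comm]; exact h) hxnadj
        · exact h
      refine ⟨fun h => hne (congrArg e h), ?_, ?_⟩
      · exact le_cos_tangentArg_sub_of_rhombus hv b hb (hn2 i) (hn2 j) (hS.norm_eq x.2) (hdv i)
          (hdv j) (fun h => hne (Subtype.ext h)) hxv' hsep hxu hxw
      · exact cos_tangentArg_sub_le_of_separated hv b hb (hn2 i) (hdv i) (hn2 j) (hdv j)
          (hsepij i j hne hnadj)
  have htransT : ∀ {d : ℕ} (e : Fin d → S), Set.range e = N → Function.Injective e →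
      (trianglePairs S v).ncard = (Sym2.map e ⁻¹' trianglePairs S v).ncard :=
    fun e hrange hinj => ncard_eq_ncard_preimage_sym2Map hinj fun z hz a ha => by
      rw [hrange]; exact mem_neighborSet_of_mem_trianglePairs hz ha
  have htransR : ∀ {d : ℕ} (e : Fin d → S), Set.range e = N → Function.Injective e →
      (rhombusPairs S v).ncard = (Sym2.map e ⁻¹' rhombusPairs S v).ncard :=
    fun e hrange hinj => ncard_eq_ncard_preimage_sym2Map hinj fun z hz a ha => by
      rw [hrange]; exact mem_neighborSet_of_mem_rhombusPairs hz ha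
  -- case analysis on the degree `d ∈ {1, 2, 3, 4}`
  obtain ⟨d, hdN, hd1, hd4'⟩ : ∃ d, N.ncard = d ∧ 1 ≤ d ∧ d ≤ 4 :=
    ⟨_, rfl, Nat.pos_of_ne_zero hd0, hd4⟩
  rw [hdN] at hpq
  obtain ⟨e, hmono, hrange⟩ := exists_sorted_enum θ hNfin hinjN hdN
  have hinj : Function.Injective e := hmono.injective.of_comp
  obtain ⟨hC, hP, hQ⟩ := hfacts e hrange hinj
  rw [htransT e hrange hinj, htransR e hrange hinj] at hpq ⊢
  interval_cases d
  · exact (false_of_sorted_one (fun i => θ (e i)) _ _ hP hQ hpq).elim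
  · exact (false_of_sorted_two hσ (fun i => θ (e i)) _ _ hP hQ hpq).elim
  · left
    exact ncard_eq_of_sorted_three hσ hκ (fun i => θ (e i)) hmono (neg_pi_lt_tangentArg b _).1
      (neg_pi_lt_tangentArg b _).2 hC _ _ hP hQ hpq
  · right
    exact ncard_eq_of_sorted_four hσ hκ (fun i => θ (e i)) hmono (neg_pi_lt_tangentArg b _).1
      (neg_pi_lt_tangentArg b _).2 hC _ _ hP hQ hpq

/-- **Corollary: a node of type `(p, q, 0)` has degree `3` or `4`** (and `p + q = deg v`).
[cite: Hales2012, Lemma 7] -/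
theorem IsKissingConfig.ncard_neighborSet_of_node_type {S : Set (EuclideanSpace ℝ (Fin 3))}
    (hS : IsKissingConfig S) (v : S)
    (hpq : (trianglePairs S v).ncard + (rhombusPairs S v).ncard =
      ((contactGraph S).neighborSet v).ncard)
    (hne : ((contactGraph S).neighborSet v).Nonempty) :
    ((contactGraph S).neighborSet v).ncard = 3 ∨ ((contactGraph S).neighborSet v).ncard = 4 := by
  rcases hS.node_type v hpq hne with h | h | h <;> omega


/-! ### Part H. The linear constraints of Lemma 9 at a node of type `(p, q, 0)` -/

/-- **Corner sum, four sorted directions.** In the situation of `ncard_eq_of_sorted_four`, the four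
corners at the node are the `|P|` triangle corners `α₃ = arccos (1/3)` and the corners of the
rhombus pairs, and they sum to `2π`: for any `F` with `F {i, j} = arccos (cos (tᵢ − tⱼ))` on `Q`,
`|P| · arccos (1/3) + Σ_{z ∈ Q} F z = 2π`. [cite: Hales2012, Lemma 9 (proof, constraints 1–2)] -/
theorem sum_of_sorted_four {σ κ : ℝ} (hσ : σ < 0) (hκ : -7 / 9 < κ) (t : Fin 4 → ℝ)
    (hmono : StrictMono t) (hlo : -π < t 0) (hhi : t 3 ≤ π)
    (hC : ∀ i j, i ≠ j → cos (t i - t j) = 1 / 3 ∨ cos (t i - t j) ≤ σ)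
    (P Q : Set (Sym2 (Fin 4)))
    (hP : ∀ i j, s(i, j) ∈ P → i ≠ j ∧ cos (t i - t j) = 1 / 3)
    (hQ : ∀ i j, s(i, j) ∈ Q → i ≠ j ∧ κ ≤ cos (t i - t j) ∧ cos (t i - t j) ≤ σ)
    (hpq : P.ncard + Q.ncard = 4) (F : Sym2 (Fin 4) → ℝ)
    (hF : ∀ i j, s(i, j) ∈ Q → F s(i, j) = arccos (cos (t i - t j))) :
    (P.ncard : ℝ) * arccos (1 / 3) + ∑ᶠ z ∈ Q, F z = 2 * π := by
  classical
  have hα1 := pi_div_three_lt_arccos_third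
  have hα2 := arccos_third_lt_pi_div_two
  have hπ := pi_pos
  have h01 : t 0 < t 1 := hmono (by decide)
  have h12 : t 1 < t 2 := hmono (by decide)
  have h23 : t 2 < t 3 := hmono (by decide)
  have hC' : ∀ i j, i ≠ j → cos (t i - t j) ≤ 1 / 3 := fun i j h => by
    rcases hC i j h with h' | h' <;> linarith
  -- the four gaps (three consecutive, one wrap-around), each `≥ α = arccos (1/3)`
  have hg0 : arccos (1 / 3) ≤ t 1 - t 0 :=
    arccos_third_le_of_cos_le (by linarith) (hC' 1 0 (by decide))
  have hg1 : arccos (1 / 3) ≤ t 2 - t 1 :=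
    arccos_third_le_of_cos_le (by linarith) (hC' 2 1 (by decide))
  have hg2 : arccos (1 / 3) ≤ t 3 - t 2 :=
    arccos_third_le_of_cos_le (by linarith) (hC' 3 2 (by decide))
  have hcw : cos (2 * π - (t 3 - t 0)) = cos (t 3 - t 0) := cos_two_pi_sub _
  have hg3 : arccos (1 / 3) ≤ 2 * π - (t 3 - t 0) :=
    arccos_third_le_of_cos_le (by linarith) (by rw [hcw]; exact hC' 3 0 (by decide))
  -- the diagonals `{0, 2}` and `{1, 3}` have cosine `≤ -7/9`
  have hd20 : cos (t 2 - t 0) ≤ -7 / 9 := cos_le_neg_seven_ninths (by linarith) (by linarith)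
  have hd31 : cos (t 3 - t 1) ≤ -7 / 9 := cos_le_neg_seven_ninths (by linarith) (by linarith)
  have hd02 : cos (t 0 - t 2) ≤ -7 / 9 := by rw [cos_sub_rev]; exact hd20
  have hd13 : cos (t 1 - t 3) ≤ -7 / 9 := by rw [cos_sub_rev]; exact hd31
  -- hence `P` and `Q` consist of consecutive pairs
  set C : Finset (Sym2 (Fin 4)) := {s(0, 1), s(1, 2), s(2, 3), s(0, 3)} with hCdef
  have hCcard : C.card = 4 := by rw [hCdef]; decide
  have hmemC : ∀ i j : Fin 4, i ≠ j → -7 / 9 < cos (t i - t j) → s(i, j) ∈ C := by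
    intro i j hne hcos
    fin_cases i <;> fin_cases j <;>
      simp only [Fin.zero_eta, Fin.mk_one, Fin.reduceFinMk] at hne hcos ⊢ <;>
      first
      | exact absurd rfl hne
      | (exfalso; linarith)
      | (rw [hCdef]; decide)
  have hPC : P ⊆ ↑C := by
    intro z hz
    induction z using Sym2.ind with
    | h i j =>
      obtain ⟨hne, hcos⟩ := hP i j hz
      exact hmemC i j hne (by rw [hcos]; norm_num)
  have hQC : Q ⊆ ↑C := by
    intro z hz
    induction z using Sym2.ind with
    | h i j =>
      obtain ⟨hne, hκ', -⟩ := hQ i j hz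
      exact hmemC i j hne (lt_of_lt_of_le hκ hκ')
  have hdisj : Disjoint P Q := by
    rw [Set.disjoint_left]
    intro z hzP hzQ
    induction z using Sym2.ind with
    | h i j =>
      obtain ⟨-, hcos⟩ := hP i j hzP
      obtain ⟨-, -, hle⟩ := hQ i j hzQ
      linarith
  have hPfin : P.Finite := C.finite_toSet.subset hPC
  have hQfin : Q.Finite := C.finite_toSet.subset hQC
  have hU : P ∪ Q = ↑C :=
    Set.eq_of_subset_of_ncard_le (Set.union_subset hPC hQC)
      (by rw [Set.ncard_union_eq hdisj hPfin hQfin, hpq, Set.ncard_coe_finset, hCcard])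
      C.finite_toSet
  have hcover : ∀ z ∈ C, z ∉ P → z ∈ Q := fun z hz hnP => by
    have h : z ∈ P ∪ Q := by rw [hU]; exact hz
    exact h.resolve_left hnP
  have hnotP : ∀ z ∈ Q, z ∉ P := fun z hzQ hzP => Set.disjoint_left.1 hdisj hzP hzQ
  -- index the consecutive pairs and the gaps by `k : Fin 4`
  set c : Fin 4 → Sym2 (Fin 4) := ![s(0, 1), s(1, 2), s(2, 3), s(0, 3)] with hcdef
  set g : Fin 4 → ℝ := ![t 1 - t 0, t 2 - t 1, t 3 - t 2, 2 * π - (t 3 - t 0)] with hgdef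
  have hcC : ∀ z ∈ C, ∃ k, c k = z := by
    intro z hz
    simp only [hCdef, Finset.mem_insert, Finset.mem_singleton] at hz
    rcases hz with rfl | rfl | rfl | rfl
    exacts [⟨0, rfl⟩, ⟨1, rfl⟩, ⟨2, rfl⟩, ⟨3, rfl⟩]
  have hcmem : ∀ k, c k ∈ C := by
    intro k
    fin_cases k <;> simp [hcdef, hCdef]
  have hcinj : Function.Injective c := by rw [hcdef]; decide
  have himage : ∀ R : Set (Sym2 (Fin 4)), R ⊆ ↑C →
      R = c '' ↑(Finset.univ.filter fun k => c k ∈ R) := by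
    intro R hR
    ext z
    constructor
    · intro hz
      obtain ⟨k, rfl⟩ := hcC z (hR hz)
      exact ⟨k, by simpa using hz, rfl⟩
    · rintro ⟨k, hk, rfl⟩
      simpa using hk
  have hPcount : P.ncard = (Finset.univ.filter fun k => c k ∈ P).card := by
    conv_lhs => rw [himage P hPC]
    rw [Set.ncard_image_of_injective _ hcinj, Set.ncard_coe_finset]
  have hQsum : ∑ᶠ z ∈ Q, F z = ∑ k ∈ Finset.univ.filter (fun k => c k ∈ Q), F (c k) := by
    conv_lhs => rw [himage Q hQC]
    rw [finsum_mem_image hcinj.injOn, finsum_mem_coe_finset]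
  -- the gaps
  have hsum : g 0 + g 1 + g 2 + g 3 = 2 * π := by
    simp only [hgdef, Matrix.cons_val_zero, Matrix.cons_val_one, Matrix.cons_val]
    ring
  have hgpos : ∀ k, 0 ≤ g k := by
    have h0 : 0 ≤ arccos (1 / 3) := arccos_nonneg _
    intro k
    fin_cases k <;>
      simp only [hgdef, Fin.zero_eta, Fin.mk_one, Fin.reduceFinMk, Matrix.cons_val_zero,
        Matrix.cons_val_one, Matrix.cons_val] <;> linarith
  have hgle : ∀ k, g k ≤ π := by
    have hk0 : g 0 ≤ π := by
      simp only [hgdef, Matrix.cons_val_zero]; linarith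
    have hk1 : g 1 ≤ π := by
      simp only [hgdef, Matrix.cons_val_one, Matrix.cons_val_zero]; linarith
    have hk2 : g 2 ≤ π := by
      simp only [hgdef, Matrix.cons_val]; linarith
    have hk3 : g 3 ≤ π := by
      simp only [hgdef, Matrix.cons_val]; linarith
    intro k
    fin_cases k
    exacts [hk0, hk1, hk2, hk3]
  have hgcos : ∀ k (i j : Fin 4), c k = s(i, j) → cos (t i - t j) = cos (g k) := by
    intro k i j hk
    fin_cases k <;>
      simp only [hcdef, hgdef, Fin.zero_eta, Fin.mk_one, Fin.reduceFinMk, Matrix.cons_val_zero,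
        Matrix.cons_val_one, Matrix.cons_val, Sym2.eq, Sym2.rel_iff'] at hk ⊢
    · rcases hk with ⟨rfl, rfl⟩ | ⟨rfl, rfl⟩
      · exact cos_sub_rev _ _
      · rfl
    · rcases hk with ⟨rfl, rfl⟩ | ⟨rfl, rfl⟩
      · exact cos_sub_rev _ _
      · rfl
    · rcases hk with ⟨rfl, rfl⟩ | ⟨rfl, rfl⟩
      · exact cos_sub_rev _ _
      · rfl
    · rw [hcw]
      rcases hk with ⟨rfl, rfl⟩ | ⟨rfl, rfl⟩
      · exact cos_sub_rev _ _
      · rfl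
  have hPgap : ∀ k, c k ∈ P → g k = arccos (1 / 3) := by
    intro k hk
    induction hz : c k using Sym2.ind with
    | h i j =>
      rw [hz] at hk
      obtain ⟨-, hcos⟩ := hP i j hk
      rw [hgcos k i j hz] at hcos
      exact eq_arccos_third_of_cos_eq (hgpos k) (hgle k) hcos
  have hQgap : ∀ k, c k ∈ Q → g k = F (c k) := by
    intro k hk
    induction hz : c k using Sym2.ind with
    | h i j =>
      rw [hz] at hk
      rw [hF i j hk, hgcos k i j hz, arccos_cos (hgpos k) (hgle k)]
  have hgval : ∀ k, g k = if c k ∈ P then arccos (1 / 3) else F (c k) := by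
    intro k
    split_ifs with h
    · exact hPgap k h
    · exact hQgap k (hcover _ (hcmem k) h)
  have hfilt : (Finset.univ.filter fun k => ¬c k ∈ P) = Finset.univ.filter fun k => c k ∈ Q := by
    ext k
    simp only [Finset.mem_filter, Finset.mem_univ, true_and]
    exact ⟨hcover _ (hcmem k), hnotP _⟩
  have htot : ∑ k, g k = 2 * π := by rw [Fin.sum_univ_four]; exact hsum
  rw [Finset.sum_congr rfl fun k _ => hgval k, Finset.sum_ite, Finset.sum_const, nsmul_eq_mul,
    hfilt] at htot
  rw [hPcount, hQsum]
  exact htot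

/-- **Corner sum, three sorted directions.** In the situation of `ncard_eq_of_sorted_three` (where
all three pairs are rhombus pairs), likewise `|P| · arccos (1/3) + Σ_{z ∈ Q} F z = 2π`.
[cite: Hales2012, Lemma 9 (proof, constraints 1–2)] -/
theorem sum_of_sorted_three {σ κ : ℝ} (hσ : σ < 0) (hκ : -7 / 9 < κ) (t : Fin 3 → ℝ)
    (hmono : StrictMono t) (hlo : -π < t 0) (hhi : t 2 ≤ π)
    (hC : ∀ i j, i ≠ j → cos (t i - t j) = 1 / 3 ∨ cos (t i - t j) ≤ σ)
    (P Q : Set (Sym2 (Fin 3)))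
    (hP : ∀ i j, s(i, j) ∈ P → i ≠ j ∧ cos (t i - t j) = 1 / 3)
    (hQ : ∀ i j, s(i, j) ∈ Q → i ≠ j ∧ κ ≤ cos (t i - t j) ∧ cos (t i - t j) ≤ σ)
    (hpq : P.ncard + Q.ncard = 3) (F : Sym2 (Fin 3) → ℝ)
    (hF : ∀ i j, s(i, j) ∈ Q → F s(i, j) = arccos (cos (t i - t j))) :
    (P.ncard : ℝ) * arccos (1 / 3) + ∑ᶠ z ∈ Q, F z = 2 * π := by
  classical
  have hα1 := pi_div_three_lt_arccos_third
  have hα2 := arccos_third_lt_pi_div_two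
  have hπ := pi_pos
  have h01 : t 0 < t 1 := hmono (by decide)
  have h12 : t 1 < t 2 := hmono (by decide)
  have hC' : ∀ i j, i ≠ j → cos (t i - t j) ≤ 1 / 3 := fun i j h => by
    rcases hC i j h with h' | h' <;> linarith
  -- the three gaps, each `≥ α`
  have hg0 : arccos (1 / 3) ≤ t 1 - t 0 :=
    arccos_third_le_of_cos_le (by linarith) (hC' 1 0 (by decide))
  have hg1 : arccos (1 / 3) ≤ t 2 - t 1 :=
    arccos_third_le_of_cos_le (by linarith) (hC' 2 1 (by decide))
  have hcw : cos (2 * π - (t 2 - t 0)) = cos (t 2 - t 0) := cos_two_pi_sub _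
  have hg2 : arccos (1 / 3) ≤ 2 * π - (t 2 - t 0) :=
    arccos_third_le_of_cos_le (by linarith) (by rw [hcw]; exact hC' 2 0 (by decide))
  -- a gap of cosine `> -7/9` is `≤ π`
  have hle : ∀ x, arccos (1 / 3) ≤ x → x ≤ 2 * π - 2 * arccos (1 / 3) → -7 / 9 < cos x →
      x ≤ π := by
    intro x h1 h2 h3
    by_contra h
    have := cos_le_neg_seven_ninths (y := x) (by linarith) h2
    linarith
  -- all pairs are consecutive here
  set C : Finset (Sym2 (Fin 3)) := {s(0, 1), s(1, 2), s(0, 2)} with hCdef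
  have hCcard : C.card = 3 := by rw [hCdef]; decide
  have hmemC : ∀ i j : Fin 3, i ≠ j → s(i, j) ∈ C := by
    intro i j hne
    fin_cases i <;> fin_cases j <;>
      simp only [Fin.zero_eta, Fin.mk_one, Fin.reduceFinMk] at hne ⊢ <;>
      first
      | exact absurd rfl hne
      | (rw [hCdef]; decide)
  have hPC : P ⊆ ↑C := by
    intro z hz
    induction z using Sym2.ind with
    | h i j => exact hmemC i j (hP i j hz).1
  have hQC : Q ⊆ ↑C := by
    intro z hz
    induction z using Sym2.ind with
    | h i j => exact hmemC i j (hQ i j hz).1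
  have hdisj : Disjoint P Q := by
    rw [Set.disjoint_left]
    intro z hzP hzQ
    induction z using Sym2.ind with
    | h i j =>
      obtain ⟨-, hcos⟩ := hP i j hzP
      obtain ⟨-, -, hle'⟩ := hQ i j hzQ
      linarith
  have hPfin : P.Finite := C.finite_toSet.subset hPC
  have hQfin : Q.Finite := C.finite_toSet.subset hQC
  have hU : P ∪ Q = ↑C :=
    Set.eq_of_subset_of_ncard_le (Set.union_subset hPC hQC)
      (by rw [Set.ncard_union_eq hdisj hPfin hQfin, hpq, Set.ncard_coe_finset, hCcard])
      C.finite_toSet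
  have hcover : ∀ z ∈ C, z ∉ P → z ∈ Q := fun z hz hnP => by
    have h : z ∈ P ∪ Q := by rw [hU]; exact hz
    exact h.resolve_left hnP
  have hnotP : ∀ z ∈ Q, z ∉ P := fun z hzQ hzP => Set.disjoint_left.1 hdisj hzP hzQ
  set c : Fin 3 → Sym2 (Fin 3) := ![s(0, 1), s(1, 2), s(0, 2)] with hcdef
  set g : Fin 3 → ℝ := ![t 1 - t 0, t 2 - t 1, 2 * π - (t 2 - t 0)] with hgdef
  have hcC : ∀ z ∈ C, ∃ k, c k = z := by
    intro z hz
    simp only [hCdef, Finset.mem_insert, Finset.mem_singleton] at hz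
    rcases hz with rfl | rfl | rfl
    exacts [⟨0, rfl⟩, ⟨1, rfl⟩, ⟨2, rfl⟩]
  have hcmem : ∀ k, c k ∈ C := by
    intro k
    fin_cases k <;> simp [hcdef, hCdef]
  have hcinj : Function.Injective c := by rw [hcdef]; decide
  have himage : ∀ R : Set (Sym2 (Fin 3)), R ⊆ ↑C →
      R = c '' ↑(Finset.univ.filter fun k => c k ∈ R) := by
    intro R hR
    ext z
    constructor
    · intro hz
      obtain ⟨k, rfl⟩ := hcC z (hR hz)
      exact ⟨k, by simpa using hz, rfl⟩
    · rintro ⟨k, hk, rfl⟩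
      simpa using hk
  have hPcount : P.ncard = (Finset.univ.filter fun k => c k ∈ P).card := by
    conv_lhs => rw [himage P hPC]
    rw [Set.ncard_image_of_injective _ hcinj, Set.ncard_coe_finset]
  have hQsum : ∑ᶠ z ∈ Q, F z = ∑ k ∈ Finset.univ.filter (fun k => c k ∈ Q), F (c k) := by
    conv_lhs => rw [himage Q hQC]
    rw [finsum_mem_image hcinj.injOn, finsum_mem_coe_finset]
  -- the gaps
  have hsum : g 0 + g 1 + g 2 = 2 * π := by
    simp only [hgdef, Matrix.cons_val_zero, Matrix.cons_val_one, Matrix.cons_val]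
    ring
  have hglo : ∀ k, arccos (1 / 3) ≤ g k := by
    intro k
    fin_cases k <;>
      simp only [hgdef, Fin.zero_eta, Fin.mk_one, Fin.reduceFinMk, Matrix.cons_val_zero,
        Matrix.cons_val_one, Matrix.cons_val] <;> linarith
  have hghi : ∀ k, g k ≤ 2 * π - 2 * arccos (1 / 3) := by
    intro k
    fin_cases k <;>
      simp only [hgdef, Fin.zero_eta, Fin.mk_one, Fin.reduceFinMk, Matrix.cons_val_zero,
        Matrix.cons_val_one, Matrix.cons_val] <;> linarith
  have hgpos : ∀ k, 0 ≤ g k := fun k => (arccos_nonneg _).trans (hglo k)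
  have hgle : ∀ k, -7 / 9 < cos (g k) → g k ≤ π := fun k hk => hle _ (hglo k) (hghi k) hk
  have hgcos : ∀ k (i j : Fin 3), c k = s(i, j) → cos (t i - t j) = cos (g k) := by
    intro k i j hk
    fin_cases k <;>
      simp only [hcdef, hgdef, Fin.zero_eta, Fin.mk_one, Fin.reduceFinMk, Matrix.cons_val_zero,
        Matrix.cons_val_one, Matrix.cons_val, Sym2.eq_iff] at hk ⊢
    · rcases hk with ⟨rfl, rfl⟩ | ⟨rfl, rfl⟩
      · exact cos_sub_rev _ _
      · rfl
    · rcases hk with ⟨rfl, rfl⟩ | ⟨rfl, rfl⟩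
      · exact cos_sub_rev _ _
      · rfl
    · rw [hcw]
      rcases hk with ⟨rfl, rfl⟩ | ⟨rfl, rfl⟩
      · exact cos_sub_rev _ _
      · rfl
  have hkey : ∀ k, ∀ z : Sym2 (Fin 3), c k = z →
      (z ∈ P → g k = arccos (1 / 3)) ∧ (z ∈ Q → g k = F z) := by
    intro k z
    induction z using Sym2.ind with
    | h i j =>
      intro hz
      constructor
      · intro hk
        obtain ⟨-, hcos⟩ := hP i j hk
        rw [hgcos k i j hz] at hcos
        exact eq_arccos_third_of_cos_eq (hgpos k) (hgle k (by rw [hcos]; norm_num)) hcos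
      · intro hk
        obtain ⟨-, hκ', -⟩ := hQ i j hk
        rw [hgcos k i j hz] at hκ'
        rw [hF i j hk, hgcos k i j hz, arccos_cos (hgpos k) (hgle k (lt_of_lt_of_le hκ hκ'))]
  have hgval : ∀ k, g k = if c k ∈ P then arccos (1 / 3) else F (c k) := by
    intro k
    split_ifs with h
    · exact (hkey k _ rfl).1 h
    · exact (hkey k _ rfl).2 (hcover _ (hcmem k) h)
  have hfilt : (Finset.univ.filter fun k => ¬c k ∈ P) = Finset.univ.filter fun k => c k ∈ Q := by
    ext k
    simp only [Finset.mem_filter, Finset.mem_univ, true_and]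
    exact ⟨hcover _ (hcmem k), hnotP _⟩
  have htot : ∑ k, g k = 2 * π := by rw [Fin.sum_univ_three]; exact hsum
  rw [Finset.sum_congr rfl fun k _ => hgval k, Finset.sum_ite, Finset.sum_const, nsmul_eq_mul,
    hfilt] at htot
  rw [hPcount, hQsum]
  exact htot

/-- **The angle of a pair of points of `S²(2)` seen from a common contact.**  If `u, w` are
contacts of a node `v` (all on `S²(2)`, `‖v − u‖ = ‖v − w‖ = 2`), their tangent directions at `v`
differ by an angle of cosine `(⟪u, w⟫ − 1)/3` (`inner_eq_one_add_three_mul_cos`), so that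
`tangentAngle ⟪u, w⟫ = arccos ((⟪u, w⟫ − 1)/3) ∈ [0, π]` (the `tangentAngle` of
`KissingRigidity.lean`) is that angle whenever it is at most `π` — in particular for every
triangle corner (`α₃`) and every rhombus corner (`≤ β₄ < π`) at `v`: in a frame at `v` it is
`arccos (cos (θ_u − θ_w))`, the tangent-angle difference reduced to `[0, π]`.  It depends only on
the pair `{u, w}`, not on `v`: the corners of a spherical rhombus `v, u, x, w` of side `2` at the
opposite nodes `v` and `x` are both `tangentAngle ⟪u, w⟫` — "the opposite angles of each rhombus
are equal", constraint 4 of the linear programs in the proof of Lemma 9.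
[cite: Hales2012, Lemma 9 (proof, constraints 1–4)] -/
theorem tangentAngle_inner_eq_arccos_cos {v u w : EuclideanSpace ℝ (Fin 3)} (hv : ‖v‖ = 2)
    (b : OrthonormalBasis (Fin 3) ℝ (EuclideanSpace ℝ (Fin 3))) (hb : b 2 = (1 / 2 : ℝ) • v)
    (hu : ‖u‖ = 2) (hdu : dist u v = 2) (hw : ‖w‖ = 2) (hdw : dist w v = 2) :
    tangentAngle ⟪u, w⟫ = arccos (cos (tangentArg b u - tangentArg b w)) := by
  rw [tangentAngle, inner_eq_one_add_three_mul_cos hv b hb hu hdu hw hdw]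
  congr 1
  ring

/-- **Constraint 2: "each angle of a triangle is `α₃`."**  Two points of `S²(2)` at distance `2`
have `tangentAngle ⟪u, w⟫ = arccos (1/3)`. [cite: Hales2012, Lemma 9 (proof, constraint 2)] -/
theorem tangentAngle_inner_eq_arccos_third {u w : EuclideanSpace ℝ (Fin 3)} (hu : ‖u‖ = 2)
    (hw : ‖w‖ = 2) (h : dist u w = 2) : tangentAngle ⟪u, w⟫ = arccos (1 / 3) := by
  rw [tangentAngle, inner_eq_two_of_dist_eq_two hu hw h]
  norm_num

/-- Two points of `S²(2)` at distance `≥ 2h₀` have `⟪u, w⟫ ≤ 4 − 2h₀²`. [folklore] -/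
theorem inner_le_of_separated {u w : EuclideanSpace ℝ (Fin 3)} (hu : ‖u‖ = 2) (hw : ‖w‖ = 2)
    (h : 2 * hales_h0 ≤ dist u w) : ⟪u, w⟫ ≤ 4 - 2 * hales_h0 ^ 2 := by
  have h0 : 0 ≤ 2 * hales_h0 := by rw [hales_h0_eq]; norm_num
  have h2 : (2 * hales_h0) ^ 2 ≤ dist u w ^ 2 := pow_le_pow_left₀ h0 h 2
  rw [dist_eq_norm, norm_sub_sq_real, hu, hw] at h2
  nlinarith [h2]

/-- **The rhombus bound at the level of inner products.**  For a rhombus `v, u, x, w` of side `2`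
on `S²(2)` (`u ≠ w`, `x ≠ v`) with `‖x − v‖ ≥ 2h₀`: `⟪u, w⟫ ≥ (4h₀² − 8)/(4 − h₀²)`, by
`(4 + ⟪u, w⟫)(4 + ⟪v, x⟫) = 16` (`rhombus_inner_mul_eq`). [cite: Hales2012, Lemma 7 (proof,
table (7), `β₄`)] -/
theorem le_inner_of_rhombus {v u w x : EuclideanSpace ℝ (Fin 3)} (hv : ‖v‖ = 2) (hu : ‖u‖ = 2)
    (hw : ‖w‖ = 2) (hx : ‖x‖ = 2) (hdu : dist u v = 2) (hdw : dist w v = 2) (huw : u ≠ w)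
    (hxv : x ≠ v) (hsep : 2 * hales_h0 ≤ dist x v) (hxu : dist x u = 2) (hxw : dist x w = 2) :
    (4 * hales_h0 ^ 2 - 8) / (4 - hales_h0 ^ 2) ≤ ⟪u, w⟫ := by
  have n4 : ∀ y : EuclideanSpace ℝ (Fin 3), ‖y‖ = 2 → ⟪y, y⟫ = 4 := fun y hy => by
    rw [real_inner_self_eq_norm_sq, hy]; norm_num
  have hvu : ⟪v, u⟫ = 2 := by rw [real_inner_comm]; exact inner_eq_two_of_dist_eq_two hu hv hdu
  have hvw : ⟪v, w⟫ = 2 := by rw [real_inner_comm]; exact inner_eq_two_of_dist_eq_two hw hv hdw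
  have hxu' : ⟪x, u⟫ = 2 := inner_eq_two_of_dist_eq_two hx hu hxu
  have hxw' : ⟪x, w⟫ = 2 := inner_eq_two_of_dist_eq_two hx hw hxw
  have hR := rhombus_smul_add_eq (n4 v hv) (n4 u hu) (n4 x hx) (n4 w hw) hvu hvw hxu' hxw'
    (Ne.symm hxv) huw
  have hprod : (4 + ⟪u, w⟫) * (4 + ⟪v, x⟫) = 16 := rhombus_inner_mul_eq (n4 v hv) hvu hvw hR
  have hvx : ⟪v, x⟫ ≤ 4 - 2 * hales_h0 ^ 2 := by
    rw [real_inner_comm]; rw [dist_comm] at hsep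
    exact inner_le_of_separated hx hv (by rwa [dist_comm])
  have hA : 0 ≤ 4 + ⟪u, w⟫ := by
    have h1 := abs_real_inner_le_norm u w
    rw [hu, hw] at h1
    have h2 := neg_abs_le ⟪u, w⟫
    linarith
  have hkey : 16 ≤ (4 + ⟪u, w⟫) * (8 - 2 * hales_h0 ^ 2) := by
    nlinarith [mul_nonneg hA (sub_nonneg.2 hvx)]
  have hden : 0 < 4 - hales_h0 ^ 2 := by rw [hales_h0_eq]; norm_num
  rw [div_le_iff₀ hden]
  nlinarith [hkey]

/-- **The corner angle of a pair of points of `S`** (`tangentAngle ⟪u, w⟫` on unordered pairs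
`{u, w}`, with the `tangentAngle s = arccos ((s − 1)/3)` of `KissingRigidity.lean`): the corner of
a triangular or quadrilateral face at a node, as a function of the pair of the node's two
neighbours along the face. [cite: Hales2012, Lemma 9 (proof, constraints 1–4)] -/
def cornerAngle (S : Set (EuclideanSpace ℝ (Fin 3))) : Sym2 S → ℝ :=
  Sym2.lift ⟨fun u w => tangentAngle ⟪(u : EuclideanSpace ℝ (Fin 3)), w⟫,
    fun u w => show tangentAngle ⟪(u : EuclideanSpace ℝ (Fin 3)), w⟫ =
      tangentAngle ⟪(w : EuclideanSpace ℝ (Fin 3)), u⟫ by rw [real_inner_comm]⟩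

/-- `cornerAngle` on an explicit pair. [folklore] -/
@[simp] theorem cornerAngle_mk (S : Set (EuclideanSpace ℝ (Fin 3))) (u w : S) :
    cornerAngle S s(u, w) = tangentAngle ⟪(u : EuclideanSpace ℝ (Fin 3)), w⟫ := rfl

/-- **Constraint 2 at a node: a triangle corner is `α₃ = arccos (1/3)`.**
[cite: Hales2012, Lemma 9 (proof, constraint 2)] -/
theorem IsKissingConfig.cornerAngle_of_mem_trianglePairs {S : Set (EuclideanSpace ℝ (Fin 3))}
    (hS : IsKissingConfig S) {v : S} {z : Sym2 S} (hz : z ∈ trianglePairs S v) :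
    cornerAngle S z = arccos (1 / 3) := by
  induction z using Sym2.ind with
  | h u w =>
    rw [mk_mem_trianglePairs] at hz
    exact tangentAngle_inner_eq_arccos_third (hS.norm_eq u.2) (hS.norm_eq w.2) hz.1

/-- **Constraint 3 at a node: "each angle of each rhombus lies between `α₄` and `β₄`"**, with
`cos α₄ = 1 − (2h₀)²/6` and `cos β₄ = (5h₀² − 12)/(3(4 − h₀²))` (table (7)); here at the level
of cosines: `cos β₄ ≤ (⟪u, w⟫ − 1)/3 ≤ cos α₄` for a rhombus pair `{u, w}`.
[cite: Hales2012, Lemma 9 (proof, constraint 3); Lemma 7 (table (7))] -/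
theorem IsKissingConfig.cos_bounds_of_mem_rhombusPairs {S : Set (EuclideanSpace ℝ (Fin 3))}
    (hS : IsKissingConfig S) {v u w : S} (hz : s(u, w) ∈ rhombusPairs S v) :
    (5 * hales_h0 ^ 2 - 12) / (3 * (4 - hales_h0 ^ 2)) ≤
        (⟪(u : EuclideanSpace ℝ (Fin 3)), w⟫ - 1) / 3 ∧
      (⟪(u : EuclideanSpace ℝ (Fin 3)), w⟫ - 1) / 3 ≤ 1 - (2 * hales_h0) ^ 2 / 6 := by
  rw [mk_mem_rhombusPairs] at hz
  obtain ⟨hne, hnadj, ⟨hvu, hvw⟩, x, hxv, hxnadj, hxu, hxw⟩ := hz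
  rw [contactGraph_adj] at hvu hvw hxu hxw hnadj hxnadj
  have hu := hS.norm_eq u.2
  have hw := hS.norm_eq w.2
  have hv := hS.norm_eq v.2
  have hx := hS.norm_eq x.2
  have hne' : (u : EuclideanSpace ℝ (Fin 3)) ≠ w := fun h => hne (Subtype.ext h)
  have hxv' : (x : EuclideanSpace ℝ (Fin 3)) ≠ v := fun h => hxv (Subtype.ext h)
  have hsepuw : 2 * hales_h0 ≤ dist (u : EuclideanSpace ℝ (Fin 3)) w := by
    rcases hS.2.2 _ u.2 _ w.2 with h | h | h
    · exact absurd h hne'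
    · exact absurd h hnadj
    · exact h
  have hsepxv : 2 * hales_h0 ≤ dist (x : EuclideanSpace ℝ (Fin 3)) v := by
    rcases hS.2.2 _ x.2 _ v.2 with h | h | h
    · exact absurd h hxv'
    · exact absurd (by rw [dist_comm]; exact h) hxnadj
    · exact h
  have hden : (0 : ℝ) < 4 - hales_h0 ^ 2 := by rw [hales_h0_eq]; norm_num
  constructor
  · have h := le_inner_of_rhombus hv hu hw hx (by rw [dist_comm]; exact hvu)
      (by rw [dist_comm]; exact hvw) hne' hxv' hsepxv hxu hxw
    rw [div_le_iff₀ hden] at h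
    rw [div_le_div_iff₀ (by positivity) (by norm_num : (0 : ℝ) < 3)]
    nlinarith [h, hden]
  · have h := inner_le_of_separated hu hw hsepuw
    linarith

/-- **Constraint 3 at a node, angle form: `α₄ ≤ corner ≤ β₄` for a rhombus corner**, where
`α₄ = arccos (1 − (2h₀)²/6)` and `β₄ = arccos ((5h₀² − 12)/(3(4 − h₀²)))`.
[cite: Hales2012, Lemma 9 (proof, constraint 3); Lemma 7 (table (7))] -/
theorem IsKissingConfig.cornerAngle_bounds_of_mem_rhombusPairs
    {S : Set (EuclideanSpace ℝ (Fin 3))} (hS : IsKissingConfig S) {v : S} {z : Sym2 S}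
    (hz : z ∈ rhombusPairs S v) :
    arccos (1 - (2 * hales_h0) ^ 2 / 6) ≤ cornerAngle S z ∧
      cornerAngle S z ≤ arccos ((5 * hales_h0 ^ 2 - 12) / (3 * (4 - hales_h0 ^ 2))) := by
  induction z using Sym2.ind with
  | h u w =>
    obtain ⟨hlo, hhi⟩ := hS.cos_bounds_of_mem_rhombusPairs hz
    rw [cornerAngle_mk, tangentAngle]
    exact ⟨arccos_le_arccos hhi, arccos_le_arccos hlo⟩

/-- Transfer of a sum over pairs along an injective enumeration (companion of
`ncard_eq_ncard_preimage_sym2Map`). [folklore] -/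
theorem finsum_mem_eq_of_sym2Map {α β : Type*} {e : α → β} (hinj : Function.Injective e)
    {R : Set (Sym2 β)} (hR : ∀ z ∈ R, ∀ b ∈ z, b ∈ Set.range e) (F : Sym2 β → ℝ) :
    ∑ᶠ z ∈ R, F z = ∑ᶠ y ∈ Sym2.map e ⁻¹' R, F (Sym2.map e y) := by
  have hsub : R ⊆ Set.range (Sym2.map e) := by
    intro z hz
    induction z using Sym2.ind with
    | h a b =>
      obtain ⟨i, hi⟩ := hR _ hz a (Sym2.mem_mk_left a b)
      obtain ⟨j, hj⟩ := hR _ hz b (Sym2.mem_mk_right a b)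
      exact ⟨s(i, j), by rw [Sym2.map_mk, hi, hj]⟩
  conv_lhs => rw [← Set.image_preimage_eq_of_subset hsub]
  exact finsum_mem_image (Sym2.map.injective hinj).injOn

/-- **Hales 2012, Lemma 9 — the linear constraints at a node, proved.**  "There are some linear
programming constraints that are immediately available to us. 1. The angles around each node
sum to `2π`. 2. Each angle of a triangle is `α₃`. 3. Each angle of each rhombus lies between `α₄`
and `β₄`. 4. The opposite angles of each rhombus are equal."  At a node `v` of type `(p, q, 0)`
of the contact graph of a kissing configuration `S` (every corner a triangle or rhombus corner:
`p + q = deg v ≥ 1`, see `IsKissingConfig.node_type`), constraints 1 and 2 read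
`p · arccos (1/3) + Σ_{rhombus pairs {u, w} at v} cornerAngle {u, w} = 2π`; constraint 3 is
`cornerAngle_bounds_of_mem_rhombusPairs`, and constraint 4 holds by construction (the corner
of the rhombus `v, u, x, w` at `x` is the same number `cornerAngle {u, w}`).
[cite: Hales2012, Lemma 9 (proof, constraints 1–4)] -/
theorem IsKissingConfig.corner_sum {S : Set (EuclideanSpace ℝ (Fin 3))} (hS : IsKissingConfig S)
    (v : S)
    (hpq : (trianglePairs S v).ncard + (rhombusPairs S v).ncard =
      ((contactGraph S).neighborSet v).ncard)
    (hne : ((contactGraph S).neighborSet v).Nonempty) :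
    ((trianglePairs S v).ncard : ℝ) * arccos (1 / 3) +
        ∑ᶠ z ∈ rhombusPairs S v, cornerAngle S z = 2 * π := by
  classical
  obtain ⟨hσ, hκ⟩ := node_type_thresholds
  set σ₀ : ℝ := 1 - (2 * hales_h0) ^ 2 / 6 with hσ₀
  set κ₀ : ℝ := (5 * hales_h0 ^ 2 - 12) / (3 * (4 - hales_h0 ^ 2)) with hκ₀
  set G := contactGraph S with hG
  set N := G.neighborSet v with hN
  have hv : ‖(v : EuclideanSpace ℝ (Fin 3))‖ = 2 := hS.norm_eq v.2
  obtain ⟨b, hb⟩ := exists_orthonormalBasis_third_eq hv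
  set θ : S → ℝ := fun u => tangentArg b u with hθ
  have hNdist : ∀ u : S, u ∈ N → dist (u : EuclideanSpace ℝ (Fin 3)) v = 2 := fun u hu => by
    rw [hN, SimpleGraph.mem_neighborSet, hG, contactGraph_adj] at hu
    rwa [dist_comm]
  haveI : Finite S := hS.finite.to_subtype
  have hNfin : N.Finite := Set.toFinite N
  have hinjN : Set.InjOn θ N := fun u hu w hw h =>
    Subtype.ext (eq_of_tangentArg_eq hv b hb (hS.norm_eq u.2) (hNdist u hu) (hS.norm_eq w.2)
      (hNdist w hw) h)
  have hd4 : N.ncard ≤ 4 := hS.ncard_neighborSet_le_four v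
  have hd0 : N.ncard ≠ 0 := by
    rw [Ne, Set.ncard_eq_zero hNfin]
    exact hne.ne_empty
  -- facts along an injective enumeration of the neighbours
  have hfacts : ∀ {d : ℕ} (e : Fin d → S), Set.range e = N → Function.Injective e →
      (∀ i j, i ≠ j → cos (θ (e i) - θ (e j)) = 1 / 3 ∨ cos (θ (e i) - θ (e j)) ≤ σ₀) ∧
      (∀ i j, s(i, j) ∈ Sym2.map e ⁻¹' trianglePairs S v →
        i ≠ j ∧ cos (θ (e i) - θ (e j)) = 1 / 3) ∧
      (∀ i j, s(i, j) ∈ Sym2.map e ⁻¹' rhombusPairs S v →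
        i ≠ j ∧ κ₀ ≤ cos (θ (e i) - θ (e j)) ∧ cos (θ (e i) - θ (e j)) ≤ σ₀) ∧
      (∀ i j, s(i, j) ∈ Sym2.map e ⁻¹' rhombusPairs S v →
        (fun y => cornerAngle S (Sym2.map e y)) s(i, j) =
          arccos (cos (θ (e i) - θ (e j)))) := by
    intro d e hrange hinj
    have hmemN : ∀ i, e i ∈ N := fun i => hrange ▸ Set.mem_range_self i
    have hdv : ∀ i, dist (e i : EuclideanSpace ℝ (Fin 3)) v = 2 := fun i => hNdist _ (hmemN i)
    have hn2 : ∀ i, ‖(e i : EuclideanSpace ℝ (Fin 3))‖ = 2 := fun i => hS.norm_eq (e i).2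
    have hsepij : ∀ i j, e i ≠ e j → ¬G.Adj (e i) (e j) →
        2 * hales_h0 ≤ dist (e i : EuclideanSpace ℝ (Fin 3)) (e j) := by
      intro i j hne hnadj
      rcases hS.2.2 _ (e i).2 _ (e j).2 with h | h | h
      · exact absurd (Subtype.ext h) hne
      · exact absurd h hnadj
      · exact h
    refine ⟨fun i j hij => ?_, fun i j hij => ?_, fun i j hij => ?_, fun i j _ => ?_⟩
    · have hne : e i ≠ e j := fun h => hij (hinj h)
      by_cases hadj : G.Adj (e i) (e j)
      · exact Or.inl (cos_tangentArg_sub_eq_third hv b hb (hn2 i) (hdv i) (hn2 j) (hdv j) hadj)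
      · exact Or.inr (cos_tangentArg_sub_le_of_separated hv b hb (hn2 i) (hdv i) (hn2 j) (hdv j)
          (hsepij i j hne hadj))
    · rw [Set.mem_preimage, Sym2.map_mk, mk_mem_trianglePairs] at hij
      obtain ⟨huw, -, -⟩ := hij
      exact ⟨fun h => G.ne_of_adj huw (congrArg e h),
        cos_tangentArg_sub_eq_third hv b hb (hn2 i) (hdv i) (hn2 j) (hdv j) huw⟩
    · have hb2 := hS.cos_bounds_of_mem_rhombusPairs hij
      rw [Set.mem_preimage, Sym2.map_mk, mk_mem_rhombusPairs] at hij
      obtain ⟨hne, -⟩ := hij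
      rw [inner_eq_one_add_three_mul_cos hv b hb (hn2 i) (hdv i) (hn2 j) (hdv j)] at hb2
      refine ⟨fun h => hne (congrArg e h), ?_, ?_⟩
      · linarith [hb2.1]
      · linarith [hb2.2]
    · show cornerAngle S (Sym2.map e s(i, j)) = _
      rw [Sym2.map_mk, cornerAngle_mk]
      exact tangentAngle_inner_eq_arccos_cos hv b hb (hn2 i) (hdv i) (hn2 j) (hdv j)
  have htransT : ∀ {d : ℕ} (e : Fin d → S), Set.range e = N → Function.Injective e →
      (trianglePairs S v).ncard = (Sym2.map e ⁻¹' trianglePairs S v).ncard :=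
    fun e hrange hinj => ncard_eq_ncard_preimage_sym2Map hinj fun z hz a ha => by
      rw [hrange]; exact mem_neighborSet_of_mem_trianglePairs hz ha
  have htransR : ∀ {d : ℕ} (e : Fin d → S), Set.range e = N → Function.Injective e →
      (rhombusPairs S v).ncard = (Sym2.map e ⁻¹' rhombusPairs S v).ncard :=
    fun e hrange hinj => ncard_eq_ncard_preimage_sym2Map hinj fun z hz a ha => by
      rw [hrange]; exact mem_neighborSet_of_mem_rhombusPairs hz ha
  have htransS : ∀ {d : ℕ} (e : Fin d → S), Set.range e = N → Function.Injective e →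
      ∑ᶠ z ∈ rhombusPairs S v, cornerAngle S z =
        ∑ᶠ y ∈ Sym2.map e ⁻¹' rhombusPairs S v, cornerAngle S (Sym2.map e y) :=
    fun e hrange hinj => finsum_mem_eq_of_sym2Map hinj (fun z hz a ha => by
      rw [hrange]; exact mem_neighborSet_of_mem_rhombusPairs hz ha) _
  -- case analysis on the degree `d ∈ {1, 2, 3, 4}`
  obtain ⟨d, hdN, hd1, hd4'⟩ : ∃ d, N.ncard = d ∧ 1 ≤ d ∧ d ≤ 4 :=
    ⟨_, rfl, Nat.pos_of_ne_zero hd0, hd4⟩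
  rw [hdN] at hpq
  obtain ⟨e, hmono, hrange⟩ := exists_sorted_enum θ hNfin hinjN hdN
  have hinj : Function.Injective e := hmono.injective.of_comp
  obtain ⟨hC, hP, hQ, hF⟩ := hfacts e hrange hinj
  rw [htransT e hrange hinj, htransR e hrange hinj] at hpq
  rw [htransT e hrange hinj, htransS e hrange hinj]
  interval_cases d
  · exact (false_of_sorted_one (fun i => θ (e i)) _ _ hP hQ hpq).elim
  · exact (false_of_sorted_two hσ (fun i => θ (e i)) _ _ hP hQ hpq).elim
  · exact sum_of_sorted_three hσ hκ (fun i => θ (e i)) hmono (neg_pi_lt_tangentArg b _).1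
      (neg_pi_lt_tangentArg b _).2 hC _ _ hP hQ hpq _ hF
  · exact sum_of_sorted_four hσ hκ (fun i => θ (e i)) hmono (neg_pi_lt_tangentArg b _).1
      (neg_pi_lt_tangentArg b _).2 hC _ _ hP hQ hpq _ hF

/-- **The node equations of the linear programs, by node type.**  Combining `corner_sum` with
`node_type`: at a node of type `(p, q, 0)` the rhombus corners sum to `2π` (type `(0, 3)`),
`2π − arccos (1/3)` (type `(1, 3)`) or `2π − 2 arccos (1/3)` (type `(2, 2)`).
[cite: Hales2012, Lemma 9 (proof, constraints 1–2); Lemma 7] -/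
theorem IsKissingConfig.rhombus_corner_sum {S : Set (EuclideanSpace ℝ (Fin 3))}
    (hS : IsKissingConfig S) (v : S)
    (hpq : (trianglePairs S v).ncard + (rhombusPairs S v).ncard =
      ((contactGraph S).neighborSet v).ncard)
    (hne : ((contactGraph S).neighborSet v).Nonempty) :
    (trianglePairs S v).ncard = 0 ∧ (rhombusPairs S v).ncard = 3 ∧
        ∑ᶠ z ∈ rhombusPairs S v, cornerAngle S z = 2 * π ∨
      (trianglePairs S v).ncard = 1 ∧ (rhombusPairs S v).ncard = 3 ∧
        ∑ᶠ z ∈ rhombusPairs S v, cornerAngle S z = 2 * π - arccos (1 / 3) ∨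
      (trianglePairs S v).ncard = 2 ∧ (rhombusPairs S v).ncard = 2 ∧
        ∑ᶠ z ∈ rhombusPairs S v, cornerAngle S z = 2 * π - 2 * arccos (1 / 3) := by
  have hsum := hS.corner_sum v hpq hne
  rcases hS.node_type v hpq hne with ⟨hp, hq⟩ | ⟨hp, hq⟩ | ⟨hp, hq⟩
  · left
    rw [hp] at hsum
    refine ⟨hp, hq, ?_⟩
    push_cast at hsum
    linarith
  · right; left
    rw [hp] at hsum
    refine ⟨hp, hq, ?_⟩
    push_cast at hsum
    linarith
  · right; right
    rw [hp] at hsum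
    refine ⟨hp, hq, ?_⟩
    push_cast at hsum
    linarith

end Literature.Geometry.DiscreteGeometry
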